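import Literature.NumberTheory.Sieve.ParityWave0
import Literature.NumberTheory.Sieve.SieveFunctions
import Literature.NumberTheory.Sieve.BatemanHornProofs
import Literature.NumberTheory.Sieve.AletheiaZomleferFukshanskyGarcia2020Applications
import HarnessLib

/-!
# Iwaniec (1978): `n² + 1 = P₂` infinitely often — decomposition of the printed proof

Source: H. Iwaniec, *Almost-primes represented by quadratic polynomials*, Invent. Math. **47**
(1978) 171–188 [cite: IwaniecInventiones1978, Theorem p. 172], read in full from the GDZ scan.
The target fact of this topic is `Literature.NumberTheory.Sieve.setOf_isAtMostAlmostPrime_two_sq_add_one_infinite`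
(inventory id parity.S19, `Literature/NumberTheory/Sieve/ParityWave0.lean`): `Ω(n² + 1) ≤ 2` for
infinitely many `n`.  Statement check: the paper's (single, unnumbered) Theorem, p. 172, reads "Let
`G(n) = an² + bn + c` be an irreducible polynomial with `a > 0` and `c ≡ 1 (mod 2)`. Then there
exist infinitely many integers `n` such that `G(n)` has at most two prime factors. Moreover, if `x`
is sufficiently large, `|{n ≤ x; G(n) = P₂}| > (1/77) Γ_G x / log x` (1)", where `P_r` denotes a
number having at most `r` prime factors COUNTED WITH MULTIPLICITY (p. 171) and
`Γ_G = (1/g) ∏_p (1 − ρ(p)/p)(1 − 1/p)⁻¹`, `g = deg G`; the proof is printed for `G = n² + 1` only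
("the general case being similar").  So parity.S19 is the faithful qualitative clause for `n² + 1`
(not mis-stated; its docstring's "Thm 1" is the paper's only Theorem).

SIZE: XL.  The printed proof needs several inputs absent from Mathlib and from this tree,
vendored below as named facts (D-0014, `def … : Prop`, numbered as in the paper), and the cheap
steps are PROVED:

* §2, Lemma 1 (p. 173) — Richert's (1969/unpublished) logarithmic weights `w(n)` detect numbers with
  at most two distinct prime factors: PROVED (`card_primeFactors_le_two_of_richertWeight_pos`).
* §2, p. 173 — the non-squarefree elements of `𝒜 = {n² + 1 : n ≤ x}` coprime to `P(z)` are
  `O(x z^{-1/2})`: PROVED (`card_nonSquarefree_le`, with the constant `7`).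
* §2, (2) p. 173 with the choice `z = x^{1/5}` of p. 187 — `W(𝒜, z) > (1/77) Γ x / log x` for all
  large `x`: named fact `weightedSum_lower` (this is the analytic heart: §§3–6).
* §2, (3) p. 174 — `W(𝒜, z)` in terms of the sifting functions `S(𝒜_q, u)`, including Buchstab's
  identity: PROVED (`weightedSum_eq`, `siftedCount_buchstab`; the sign of the double sum in the
  printed (3) is corrected, see the section docstring).
* PROVED here: (2) ⟹ parity.S19
  (`setOf_isAtMostAlmostPrime_two_sq_add_one_infinite_of_weightedSum_lower`), via Lemma 1, the
  non-squarefree bound and `Γ > 0`; positivity of `Γ = hardyLittlewoodEConst / 2` is the tree's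
  PROVED Bateman–Horn convergence theorem (`IsBatemanHornSystem.hasBatemanHornConst_holds`,
  `isBatemanHornSystem_X_sq_add_one`), which is why this file imports the two
  `…Proofs`/`…Applications` modules.
* §3, Lemma 2 (p. 175) = Iwaniec's linear sieve with the bilinear form of the remainder term, quoted
  in 1978 from the then unpublished [11]; vendored in its PUBLISHED form
  [cite: IwaniecActaArith1980b, Theorem 1] (`lemma2_bilinearSieve`), see the docstring for the
  difference with the 1978 display.
* §4, Proposition 1 and its Corollary (p. 176; level of distribution `x^{16/15}` in bilinear form
  for `n² + 1`) and the external input of Lemma 4, Lemma 6 (p. 178; Hooley's bound for incomplete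
  Kloosterman sums, from Weil's bound): named facts `proposition1`, `proposition1_corollary`,
  `lemma6_hooley`.  Lemma 4 itself (p. 177; equidistribution of the roots of
  `Ω² + 1 ≡ 0 (mod mq)`) is NOT vendored: its printed main term is too large by the factor
  `π²/6` (see the note in §4 below); Lemma 5 (Gauss–Lagrange, needs `D ≠ 2` as printed) and
  Lemma 7 (Fourier majorants of an interval) are elementary and left with it to the session that
  attacks Proposition 1.
* §5, Proposition 2 (p. 185; the sifting functions `S(𝒜_q; z_q)` on average over `q < x^{1−ε}` with
  level `y = x^{16/15}`): named facts `proposition2_upper` / `proposition2_lower`.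
* §6, p. 187 — the formulas for `s F(s)` on `[3, 5]` and `s f(s)` on `[4, 6]` (and the elementary
  ranges) follow from the delay-differential characterisation: PROVED
  (`IsLinearSieveFunctions.mul_upper_eq`, `IsLinearSieveFunctions.mul_lower_eq_of_le_six`), as is
  the `C¹` regularity of `F` on `(0, ∞)` across `s = 3` (`IsLinearSieveFunctions.hasDerivAt_upper'`,
  `IsLinearSieveFunctions.continuousOn_upperDeriv`) needed for the partial summations of §6.
* §1, the Theorem itself in its general quantitative form (1): named fact `theorem_quadratic`, and
  its `n² + 1` case `card_P2_lower` (display (1) for `G = n² + 1`).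

DAG (what proves what, for later sessions; see NOTES.md of the tenure folder):
`S19 ⇐ weightedSum_lower ∧ Γ>0` (proved here) · `weightedSum_lower ⇐ (3) (proved) +
proposition2_* + Mertens-type asymptotics for V(z), ∑ ρ(p)/p + §6 numerics (F, f on [3,5], [4,6],
proved here; W > 2e^C γ/154 at α = 16/15, γ = 1/5)` · `proposition2 ⇐ lemma2_bilinearSieve +
proposition1_corollary` · `proposition1 ⇐ Lemma 4 (corrected: main term × 6/π²) ⇐ Lemma 5 +
lemma6_hooley + Lemma 7`.

Secondary sources used for cross-checking the architecture: Lemke Oliver, Acta Arith. 151 (2012)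
241–261 [cite: LemkeOliverActaArith2012, §2] (same skeleton for every irreducible quadratic) and the
exposition arXiv:1910.02885 (which re-derives `W > 2e^C γ · 0.01405 > 2e^C γ/154`).

Design notes.
* `x : ℝ` is Iwaniec's main parameter; `𝒜 = {n² + 1 : 1 ≤ n ≤ x}` is realised through
  `n ∈ Finset.Icc 1 ⌊x⌋₊`; `P(z) = Literature.primesProdBelow z` (`SieveFramework`); `ρ(d)` is the local
  root count `rho d = #{ν mod d : ν² + 1 ≡ 0}`.
* Richert's weight `richertWeight lam x n = 1 − (3 − λ)⁻¹ ∑_{p ∣ n, p < x} ω_p(n)` with Iwaniec's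
  three-case `ω_p(n)` (`omegaWeight`), `p_n = Nat.minFac n`.
* All "≪_ε" statements are rendered `∀ ε > 0, ∃ C, ∀ …` with the uniformity printed in the paper;
  "x > x₀(ε, γ)" is `∃ x₀, ∀ x ≥ x₀` with `x₀` independent of the families `c_q, z_q`.
* The linear-sieve functions `F, f` enter only through the predicate `IsLinearSieveFunctions`
  (Iwaniec's delay-differential characterisation, p. 175), not through the `Classical.epsilon`
  constants `Literature.upperSieveFun 1`, `Literature.lowerSieveFun 1` of `SieveFunctions.lean`, so that the facts
  below do not depend on the named fact `Literature.NumberTheory.Sieve.exists_isBetaSieveData`.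
-/

open Filter Finset Real
open scoped ArithmeticFunction.Omega Polynomial Topology

noncomputable section

namespace Literature.NumberTheory.Sieve.Iwaniec1978

/-! ### §2. Richert's weights and Lemma 1 -/

/-- Iwaniec's `ω_p(n)` (p. 172), for a prime `p ∣ n`, `p < x`, with `p_n = Nat.minFac n` the least
prime factor of `n`: `ω_p(n) = 1 − log p / log x` if `p = p_n`; `= log p_n / log x` if `p > p_n` and
`p < x^{1/2}`; `= 1 − log p / log x` if `p > p_n` and `p ≥ x^{1/2}`.
[cite: IwaniecInventiones1978, §2 p. 172] -/
def omegaWeight (x : ℝ) (n p : ℕ) : ℝ :=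
  if p = n.minFac then 1 - Real.log p / Real.log x
  else if (p : ℝ) < x ^ (1 / 2 : ℝ) then Real.log n.minFac / Real.log x
  else 1 - Real.log p / Real.log x

/-- Richert's weight in Iwaniec's form (p. 173): for `2 ≤ λ < 3`,
`w(n) = 1 − (3 − λ)⁻¹ ∑_{p ∣ n, p < x} ω_p(n)` (sum over the prime divisors `p < x` of `n`).
[cite: IwaniecInventiones1978, §2 p. 173] -/
def richertWeight (lam x : ℝ) (n : ℕ) : ℝ :=
  1 - (3 - lam)⁻¹ * ∑ p ∈ n.primeFactors.filter (fun p : ℕ => (p : ℝ) < x), omegaWeight x n p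

/-- Each `ω_p(n)` with `p ∣ n` prime and `p < x` (`x > 1`) is nonnegative.
[cite: IwaniecInventiones1978, §2 proof of Lemma 1] -/
theorem omegaWeight_nonneg {x : ℝ} (hx : 1 < x) {n p : ℕ} (hp : p ∈ n.primeFactors)
    (hpx : (p : ℝ) < x) : 0 ≤ omegaWeight x n p := by
  have hL : 0 < Real.log x := Real.log_pos hx
  have hp0 : (0 : ℝ) < p := by exact_mod_cast (Nat.prime_of_mem_primeFactors hp).pos
  have hlogp : Real.log p ≤ Real.log x := Real.log_le_log hp0 hpx.le
  have h1 : 0 ≤ 1 - Real.log p / Real.log x := by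
    rw [sub_nonneg, div_le_one hL]; exact hlogp
  unfold omegaWeight
  split_ifs
  · exact h1
  · exact div_nonneg (Real.log_natCast_nonneg _) hL.le
  · exact h1

/-- For `x > 1` and `2 ≤ λ < 3`, Richert's weight is at most `1`.
[cite: IwaniecInventiones1978, §2 p. 173] -/
theorem richertWeight_le_one {lam x : ℝ} (h3 : lam < 3) (hx : 1 < x) (n : ℕ) :
    richertWeight lam x n ≤ 1 := by
  unfold richertWeight
  have hs : 0 ≤ ∑ p ∈ n.primeFactors.filter (fun p : ℕ => (p : ℝ) < x), omegaWeight x n p :=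
    Finset.sum_nonneg fun p hp => by
      rw [Finset.mem_filter] at hp
      exact omegaWeight_nonneg hx hp.1 hp.2
  have : 0 ≤ (3 - lam)⁻¹ * ∑ p ∈ n.primeFactors.filter (fun p : ℕ => (p : ℝ) < x),
      omegaWeight x n p :=
    mul_nonneg (inv_nonneg.mpr (by linarith)) hs
  linarith

/-- **Iwaniec 1978, Lemma 1** (p. 173) — PROVED.  If `2 ≤ λ < 3`, `x > 1`, `0 < n ≤ x^λ` and
`w(n) > 0`, then `n` has at most two distinct prime factors.  (Printed proof: two distinct prime
factors below `x^{1/2}` force `∑ ω_p(n) ≥ ω_{p_n}(n) + ω_{p'}(n) = 1 ≥ 3 − λ`; otherwise every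
`ω_p(n)` equals `1 − log p / log x`, so `∑_{p ∣ n, p < x} ω_p(n) ≥ ω(n) − log n / log x ≥ ω(n) − λ`,
whence `w(n) ≤ (3 − ω(n))/(3 − λ)`.) [cite: IwaniecInventiones1978, Lemma 1] -/
theorem card_primeFactors_le_two_of_richertWeight_pos {lam x : ℝ} {n : ℕ} (h2 : 2 ≤ lam)
    (h3 : lam < 3) (hx : 1 < x) (hn : n ≠ 0) (hnx : (n : ℝ) ≤ x ^ lam)
    (hw : 0 < richertWeight lam x n) : n.primeFactors.card ≤ 2 := by
  set L := Real.log x with hL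
  have hLpos : 0 < L := Real.log_pos hx
  set PF := n.primeFactors with hPF
  set S := ∑ p ∈ PF.filter (fun p : ℕ => (p : ℝ) < x), omegaWeight x n p with hS
  have h3l : 0 < 3 - lam := by linarith
  have hSlt : S < 3 - lam := by
    have h1 : (3 - lam)⁻¹ * S < 1 := by
      have : richertWeight lam x n = 1 - (3 - lam)⁻¹ * S := rfl
      linarith
    rwa [inv_mul_lt_iff₀ h3l, mul_one] at h1
  have hnonneg : ∀ p ∈ PF.filter (fun p : ℕ => (p : ℝ) < x), 0 ≤ omegaWeight x n p := fun p hp => by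
    rw [Finset.mem_filter] at hp
    exact omegaWeight_nonneg hx hp.1 hp.2
  by_contra hcard
  rw [not_le] at hcard
  have hsqrt_le : x ^ (1 / 2 : ℝ) ≤ x := Real.rpow_le_self_of_one_le hx.le (by norm_num)
  by_cases hA : ∃ p ∈ PF, p ≠ n.minFac ∧ (p : ℝ) < x ^ (1 / 2 : ℝ)
  · -- Case A: `p_n` and another prime factor `p` both lie below `x^{1/2}`.
    obtain ⟨p, hp, hpne, hplt⟩ := hA
    have hpprime : p.Prime := Nat.prime_of_mem_primeFactors hp
    have hmf_le : n.minFac ≤ p :=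
      Nat.minFac_le_of_dvd hpprime.two_le (Nat.dvd_of_mem_primeFactors hp)
    have hn1 : n ≠ 1 := by
      rintro rfl
      simp [hPF] at hp
    have hmf : n.minFac ∈ PF :=
      Nat.mem_primeFactors.mpr ⟨Nat.minFac_prime hn1, Nat.minFac_dvd n, hn⟩
    have hp_lt_x : (p : ℝ) < x := hplt.trans_le hsqrt_le
    have hmf_lt_x : (n.minFac : ℝ) < x := (Nat.cast_le.mpr hmf_le).trans_lt hp_lt_x
    have hsub : ({n.minFac, p} : Finset ℕ) ⊆ PF.filter (fun q : ℕ => (q : ℝ) < x) := by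
      intro q hq
      rw [Finset.mem_insert, Finset.mem_singleton] at hq
      rw [Finset.mem_filter]
      rcases hq with rfl | rfl
      · exact ⟨hmf, hmf_lt_x⟩
      · exact ⟨hp, hp_lt_x⟩
    have h1 : ∑ q ∈ ({n.minFac, p} : Finset ℕ), omegaWeight x n q = 1 := by
      rw [Finset.sum_pair (Ne.symm hpne)]
      unfold omegaWeight
      rw [if_pos rfl, if_neg hpne, if_pos hplt]
      ring
    have h1S : 1 ≤ S :=
      h1 ▸ Finset.sum_le_sum_of_subset_of_nonneg hsub fun q hq _ => hnonneg q hq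
    linarith
  · -- Case B: at most one prime factor below `x^{1/2}`; every `ω_p(n)` is `1 − log p / log x`.
    simp only [not_exists, not_and, not_lt] at hA
    have hterm : ∀ p ∈ PF.filter (fun q : ℕ => (q : ℝ) < x),
        omegaWeight x n p = 1 - Real.log p / L := by
      intro p hp
      rw [Finset.mem_filter] at hp
      unfold omegaWeight
      by_cases hpm : p = n.minFac
      · rw [if_pos hpm]
      · rw [if_neg hpm, if_neg (not_lt.mpr (hA p hp.1 hpm))]
    have hS1 : S = ∑ p ∈ PF.filter (fun q : ℕ => (q : ℝ) < x), (1 - Real.log p / L) :=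
      Finset.sum_congr rfl hterm
    have hS2 : ∑ p ∈ PF, (1 - Real.log p / L) ≤ S := by
      rw [hS1, ← Finset.sum_filter_add_sum_filter_not PF (fun q : ℕ => (q : ℝ) < x)]
      have hneg : ∑ p ∈ PF.filter (fun q : ℕ => ¬ (q : ℝ) < x), (1 - Real.log p / L) ≤ 0 := by
        refine Finset.sum_nonpos fun p hp => ?_
        rw [Finset.mem_filter, not_lt] at hp
        have hx0 : 0 < x := by linarith
        have hle : L ≤ Real.log p := Real.log_le_log hx0 hp.2
        have : 1 ≤ Real.log p / L := by rwa [le_div_iff₀ hLpos, one_mul]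
        linarith
      linarith
    have hS3 : ∑ p ∈ PF, (1 - Real.log p / L) =
        (PF.card : ℝ) - Real.log (∏ p ∈ PF, (p : ℝ)) / L := by
      rw [Finset.sum_sub_distrib, Finset.sum_const, nsmul_eq_mul, mul_one,
        Real.log_prod (fun p hp => ?_), Finset.sum_div]
      exact_mod_cast (Nat.prime_of_mem_primeFactors hp).ne_zero
    have hprod_le : Real.log (∏ p ∈ PF, (p : ℝ)) ≤ lam * L := by
      have hle : (∏ p ∈ PF, p : ℕ) ≤ n :=
        Nat.le_of_dvd (Nat.pos_of_ne_zero hn) (Nat.prod_primeFactors_dvd n)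
      have hle' : (∏ p ∈ PF, (p : ℝ)) ≤ n := by
        have h := (Nat.cast_le (α := ℝ)).mpr hle
        rwa [Nat.cast_prod] at h
      have hpos : (0 : ℝ) < ∏ p ∈ PF, (p : ℝ) :=
        Finset.prod_pos fun p hp => by exact_mod_cast (Nat.prime_of_mem_primeFactors hp).pos
      have hn0 : (0 : ℝ) < n := by exact_mod_cast Nat.pos_of_ne_zero hn
      calc Real.log (∏ p ∈ PF, (p : ℝ)) ≤ Real.log n := Real.log_le_log hpos hle'
        _ ≤ Real.log (x ^ lam) := Real.log_le_log hn0 hnx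
        _ = lam * L := Real.log_rpow (by linarith) lam
    have hcardS : (PF.card : ℝ) - lam ≤ S := by
      have h := hS2
      rw [hS3] at h
      have : Real.log (∏ p ∈ PF, (p : ℝ)) / L ≤ lam := by
        rw [div_le_iff₀ hLpos]; exact hprod_le
      linarith
    have h3c : (3 : ℝ) ≤ PF.card := by exact_mod_cast hcard
    linarith

/-- Lemma 1 in terms of Mathlib's `ω = ArithmeticFunction.cardDistinctFactors`.
[cite: IwaniecInventiones1978, Lemma 1] -/
theorem cardDistinctFactors_le_two_of_richertWeight_pos {lam x : ℝ} {n : ℕ} (h2 : 2 ≤ lam)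
    (h3 : lam < 3) (hx : 1 < x) (hn : n ≠ 0) (hnx : (n : ℝ) ≤ x ^ lam)
    (hw : 0 < richertWeight lam x n) : ArithmeticFunction.cardDistinctFactors n ≤ 2 := by
  rw [ArithmeticFunction.cardDistinctFactors_apply, ← List.card_toFinset, Nat.toFinset_factors]
  exact card_primeFactors_le_two_of_richertWeight_pos h2 h3 hx hn hnx hw

/-! ### The sequence `𝒜 = {n² + 1 : 1 ≤ n ≤ x}` and its sieve data (pp. 173–175) -/

/-- `ρ(d)`, the number of incongruent solutions of `ν² + 1 ≡ 0 (mod d)` (p. 171; `ρ(0) = 0` is a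
junk value). Equals `Literature.polyRootCountMod ![X² + 1] d` (`rho_eq_polyRootCountMod`).
[cite: IwaniecInventiones1978, §1 p. 171] -/
def rho (d : ℕ) : ℕ :=
  ((Finset.range d).filter fun ν : ℕ => d ∣ ν ^ 2 + 1).card

/-- `rho` is the tree's local root count `polyRootCountMod` of the single polynomial `X² + 1`.
[folklore] -/
theorem rho_eq_polyRootCountMod (d : ℕ) :
    rho d = polyRootCountMod ![(Polynomial.X ^ 2 + 1 : ℤ[X])] d := by
  unfold rho polyRootCountMod
  congr 1
  ext ν
  simp only [Finset.mem_filter, Fin.prod_univ_one, Matrix.cons_val_fin_one, Polynomial.eval_add,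
    Polynomial.eval_pow, Polynomial.eval_X, Polynomial.eval_one]
  exact and_congr_right fun _ => by
    exact_mod_cast (Int.natCast_dvd_natCast (m := d) (n := ν ^ 2 + 1)).symm

/-- `|𝒜_d| = #{1 ≤ n ≤ x : d ∣ n² + 1}` (p. 174, `𝒜_q`).
[cite: IwaniecInventiones1978, §2 p. 174] -/
def congrCount (x : ℝ) (d : ℕ) : ℕ :=
  ((Finset.Icc 1 ⌊x⌋₊).filter fun n : ℕ => d ∣ n ^ 2 + 1).card

/-- `r(𝒜; d) = |𝒜_d| − ρ(d) x / d`, the remainder of the level-of-distribution approximation for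
`𝒜 = {n² + 1 : n ≤ x}` with `X = x` (p. 175, below (4), and p. 176, (6)).
[cite: IwaniecInventiones1978, §3 p. 175] -/
def rem (x : ℝ) (d : ℕ) : ℝ :=
  (congrCount x d : ℝ) - (rho d : ℝ) * x / d

/-- The sifting function `S(𝒜_q, u) = #{a ∈ 𝒜_q : (a, P(u)) = 1}` of `𝒜 = {n² + 1 : 1 ≤ n ≤ x}`
(p. 174), with `P(u) = ∏_{p < u} p = Literature.primesProdBelow u`.
[cite: IwaniecInventiones1978, §2 p. 174] -/
def siftedCount (x : ℝ) (q : ℕ) (u : ℝ) : ℕ :=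
  ((Finset.Icc 1 ⌊x⌋₊).filter fun n : ℕ =>
    q ∣ n ^ 2 + 1 ∧ Nat.Coprime (n ^ 2 + 1) (primesProdBelow u)).card

/-- `V(u) = ∏_{p < u} (1 − ρ(p)/p)` (p. 175). [cite: IwaniecInventiones1978, Lemma 2] -/
def densityProd (u : ℝ) : ℝ :=
  ∏ p ∈ Nat.primesBelow ⌈u⌉₊, (1 - (rho p : ℝ) / p)

/-- Iwaniec's weighted sum `W(𝒜, z) = ∑_{a ∈ 𝒜, (a, P(z)) = 1} w(a)` for `𝒜 = {n² + 1 : 1 ≤ n ≤ x}`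
with Richert's weight at `λ = 2` (p. 173). [cite: IwaniecInventiones1978, §2 p. 173] -/
def weightedSum (x z : ℝ) : ℝ :=
  ∑ n ∈ (Finset.Icc 1 ⌊x⌋₊).filter (fun n : ℕ => Nat.Coprime (n ^ 2 + 1) (primesProdBelow z)),
    richertWeight 2 x (n ^ 2 + 1)

/-- `Γ = Γ_{n²+1} = (1/2) ∏_p (1 − ρ(p)/p)(1 − 1/p)⁻¹` (p. 171, `g = 2`), i.e. one half of the
Hardy–Littlewood Conjecture E / Bateman–Horn constant of `X² + 1` (`Literature.NumberTheory.Sieve.hardyLittlewoodEConst`, an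
ordered conditionally convergent Euler product). [cite: IwaniecInventiones1978, §1 p. 171] -/
def gamma : ℝ := hardyLittlewoodEConst / 2

/-- `Γ > 0` — PROVED in the tree: the Bateman–Horn product of the Bateman–Horn system `{X² + 1}`
converges to a positive limit (`IsBatemanHornSystem.hasBatemanHornConst_holds`,
`isBatemanHornSystem_X_sq_add_one`). [cite: BatemanHornMathComp1962, pp. 364–365] -/
theorem gamma_pos : 0 < gamma :=
  div_pos (IsBatemanHornSystem.hasBatemanHornConst_holds isBatemanHornSystem_X_sq_add_one).2 two_pos

/-! ### §1–§2. The Theorem, its display (1), and the reduction target (2) — named facts -/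

/-- **Iwaniec 1978, Theorem (p. 172), general form.**  Let `G(n) = an² + bn + c ∈ ℤ[X]` be
irreducible (in `ℤ[X]`, so in particular primitive: `3n² + 3` is excluded, as it must be) with
`a > 0` and `c` odd.  Then `G(n)` has at most two prime factors (counted with multiplicity) for
infinitely many `n`, and for all large `x`, `#{n ≤ x : G(n) = P₂} > (1/77) Γ_G x / log x` with
`Γ_G = (1/2) ∏_p (1 − ρ(p)/p)(1 − 1/p)⁻¹` (`= batemanHornConst ![G] / 2`, `ρ = polyRootCountMod`).
Rendered over positive integers `n ≤ x`, reading "`G(n) = P₂`" as "`|G(n)|` is a nonzero integer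
with at most two prime factors counted with multiplicity" (`Nat.IsAtMostAlmostPrime 2 |G(n)|`;
for `a > 0`, `G(n) > 0` for all but finitely many `n`).  The paper proves the case `G = n² + 1` and
says the general case is similar; the general case is written out in
[cite: LemkeOliverActaArith2012, Theorem 1] (there with Richert's constant suppressed).
[cite: IwaniecInventiones1978, Theorem p. 172] -/
def theorem_quadratic : Prop :=
  ∀ (a b c : ℤ), 0 < a → Odd c →
    Irreducible (Polynomial.C a * Polynomial.X ^ 2 + Polynomial.C b * Polynomial.X +
      Polynomial.C c : ℤ[X]) →
    {n : ℕ | Nat.IsAtMostAlmostPrime 2 (a * n ^ 2 + b * n + c).natAbs}.Infinite ∧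
      ∀ᶠ x : ℝ in atTop,
        batemanHornConst ![(Polynomial.C a * Polynomial.X ^ 2 + Polynomial.C b * Polynomial.X +
              Polynomial.C c : ℤ[X])] / 2 / 77 * x / Real.log x <
          ((open scoped Classical in (Finset.Icc 1 ⌊x⌋₊).filter fun n : ℕ =>
              Nat.IsAtMostAlmostPrime 2 (a * (n : ℤ) ^ 2 + b * n + c).natAbs).card : ℝ)

/-- **Iwaniec 1978, display (1) for `G = n² + 1`** (p. 172): for all sufficiently large `x`,
`#{1 ≤ n ≤ x : Ω(n² + 1) ≤ 2} > (1/77) Γ x / log x`, `Γ = gamma`.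
[cite: IwaniecInventiones1978, Theorem p. 172 (1)] -/
def card_P2_lower : Prop :=
  ∀ᶠ x : ℝ in atTop,
    gamma / 77 * x / Real.log x <
      ((open scoped Classical in
        (Finset.Icc 1 ⌊x⌋₊).filter fun n : ℕ => Nat.IsAtMostAlmostPrime 2 (n ^ 2 + 1)).card : ℝ)

/-- **Iwaniec 1978, (2) (p. 173) with the final choice `z = x^{1/5}` (p. 187, `γ = 1/5`).**
For all sufficiently large `x`, `W(𝒜, x^{1/5}) > (1/77) Γ x / log x`, where
`W(𝒜, z) = ∑_{n ≤ x, (n²+1, P(z)) = 1} w(n² + 1)` is Richert's weighted sum at `λ = 2`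
(`weightedSum`).  This is the statement the whole of §§3–6 establishes (Prop. 2 and the numerical
evaluation `W > 2e^C γ/154` at `α = 16/15`, `γ = 1/5`, p. 187); it implies parity.S19
(`setOf_isAtMostAlmostPrime_two_sq_add_one_infinite_of_weightedSum_lower`, proved below).
[cite: IwaniecInventiones1978, §2 (2) and §6 p. 187] -/
def weightedSum_lower : Prop :=
  ∀ᶠ x : ℝ in atTop, gamma / 77 * x / Real.log x < weightedSum x (x ^ (1 / 5 : ℝ))

/-! ### §2, p. 173: non-squarefree elements of `𝒜` and the reduction (2) ⟹ parity.S19 — PROVED -/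

/-- If `p² ∣ a² + 1` and `p² ∣ b² + 1` for a prime `p`, then `a ≡ ± b (mod p²)` (the two square
roots of `−1` modulo an odd prime power; `p = 2` cannot occur since `4 ∤ a² + 1`). [folklore] -/
theorem sq_dvd_sub_or_sq_dvd_add {p a b : ℕ} (hp : p.Prime) (ha : p ^ 2 ∣ a ^ 2 + 1)
    (hb : p ^ 2 ∣ b ^ 2 + 1) :
    ((p : ℤ) ^ 2 ∣ (a : ℤ) - b) ∨ ((p : ℤ) ^ 2 ∣ (a : ℤ) + b) := by
  have ha' : (p : ℤ) ^ 2 ∣ (a : ℤ) ^ 2 + 1 := by exact_mod_cast ha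
  have hb' : (p : ℤ) ^ 2 ∣ (b : ℤ) ^ 2 + 1 := by exact_mod_cast hb
  have hprod : (p : ℤ) ^ 2 ∣ ((a : ℤ) - b) * ((a : ℤ) + b) := by
    have e : ((a : ℤ) - b) * ((a : ℤ) + b) = ((a : ℤ) ^ 2 + 1) - ((b : ℤ) ^ 2 + 1) := by ring
    rw [e]; exact dvd_sub ha' hb'
  have hpi : Prime (p : ℤ) := Nat.prime_iff_prime_int.mp hp
  by_cases h1 : (p : ℤ) ∣ (a : ℤ) - b
  · by_cases h2 : (p : ℤ) ∣ (a : ℤ) + b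
    · exfalso
      have h2a : (p : ℤ) ∣ 2 * a := by
        have e : (2 * a : ℤ) = ((a : ℤ) - b) + ((a : ℤ) + b) := by ring
        rw [e]; exact dvd_add h1 h2
      rcases hpi.dvd_or_dvd h2a with h2' | hpa
      · have hp2 : p = 2 := by
          have : p ∣ 2 := by exact_mod_cast h2'
          exact (Nat.prime_dvd_prime_iff_eq hp Nat.prime_two).mp this
        subst hp2
        have h4 : 4 ∣ a ^ 2 + 1 := by norm_num at ha; exact ha
        have hz : ((a ^ 2 + 1 : ℕ) : ZMod 4) = 0 := (ZMod.natCast_eq_zero_iff _ 4).mpr h4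
        push_cast at hz
        revert hz
        generalize (a : ZMod 4) = t
        revert t
        decide
      · have hpa2 : (p : ℤ) ∣ (a : ℤ) ^ 2 + 1 := (dvd_pow_self (p : ℤ) two_ne_zero).trans ha'
        have h1' : (p : ℤ) ∣ 1 := by
          have h := dvd_sub hpa2 (dvd_mul_of_dvd_right hpa (a : ℤ))
          have e : ((a : ℤ) ^ 2 + 1) - (a : ℤ) * a = 1 := by ring
          rwa [e] at h
        exact hpi.not_dvd_one h1'
    · left
      have hcop : IsCoprime ((p : ℤ) ^ 2) ((a : ℤ) + b) :=
        ((Prime.coprime_iff_not_dvd hpi).mpr h2).pow_left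
      exact hcop.dvd_of_dvd_mul_right hprod
  · right
    have hcop : IsCoprime ((p : ℤ) ^ 2) ((a : ℤ) - b) :=
      ((Prime.coprime_iff_not_dvd hpi).mpr h1).pow_left
    exact hcop.dvd_of_dvd_mul_left hprod

/-- A residue class modulo `m ≥ 1` contains at most `X/m + 1` integers of `[1, X]`. [folklore] -/
theorem card_filter_Icc_modEq_le (m X : ℕ) (r : ℤ) :
    ((Finset.Icc 1 X).filter fun n : ℕ => (m : ℤ) ∣ (n : ℤ) - r).card ≤ X / m + 1 := by
  have hmaps : Set.MapsTo (fun n : ℕ => n / m)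
      (((Finset.Icc 1 X).filter fun n : ℕ => (m : ℤ) ∣ (n : ℤ) - r) : Set ℕ)
      ((Finset.range (X / m + 1)) : Set ℕ) := by
    intro n hn
    rw [Finset.mem_coe, Finset.mem_filter, Finset.mem_Icc] at hn
    rw [Finset.mem_coe, Finset.mem_range, Nat.lt_add_one_iff]
    exact Nat.div_le_div_right hn.1.2
  have hinj : Set.InjOn (fun n : ℕ => n / m)
      (((Finset.Icc 1 X).filter fun n : ℕ => (m : ℤ) ∣ (n : ℤ) - r) : Set ℕ) := by
    intro n₁ hn₁ n₂ hn₂ h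
    rw [Finset.mem_coe, Finset.mem_filter] at hn₁ hn₂
    have hd : (m : ℤ) ∣ (n₂ : ℤ) - n₁ := by
      have e : (n₂ : ℤ) - n₁ = ((n₂ : ℤ) - r) - ((n₁ : ℤ) - r) := by ring
      rw [e]; exact dvd_sub hn₂.2 hn₁.2
    have hmod : n₁ % m = n₂ % m := Int.natCast_modEq_iff.mp (Int.modEq_iff_dvd.mpr hd)
    simp only at h
    rw [← Nat.div_add_mod n₁ m, ← Nat.div_add_mod n₂ m, h, hmod]
  simpa using Finset.card_le_card_of_injOn _ hmaps hinj

/-- For a prime `p` there are at most `2 (X/p² + 1)` integers `1 ≤ n ≤ X` with `p² ∣ n² + 1`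
(`ρ(p²) ≤ 2` roots, each a residue class mod `p²`). [cite: IwaniecInventiones1978, §2 p. 173] -/
theorem card_filter_sq_dvd_le {p : ℕ} (hp : p.Prime) (X : ℕ) :
    ((Finset.Icc 1 X).filter fun n : ℕ => p ^ 2 ∣ n ^ 2 + 1).card ≤ 2 * (X / p ^ 2 + 1) := by
  set T := (Finset.Icc 1 X).filter fun n : ℕ => p ^ 2 ∣ n ^ 2 + 1 with hT
  rcases T.eq_empty_or_nonempty with h0 | ⟨n₀, hn₀⟩
  · rw [h0]; simp
  have hn₀' := (Finset.mem_filter.mp hn₀).2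
  have hsub : T ⊆ ((Finset.Icc 1 X).filter fun n : ℕ => ((p ^ 2 : ℕ) : ℤ) ∣ (n : ℤ) - n₀) ∪
      ((Finset.Icc 1 X).filter fun n : ℕ => ((p ^ 2 : ℕ) : ℤ) ∣ (n : ℤ) - (-(n₀ : ℤ))) := by
    intro n hn
    have hn' := Finset.mem_filter.mp hn
    rw [Finset.mem_union, Finset.mem_filter, Finset.mem_filter]
    rcases sq_dvd_sub_or_sq_dvd_add hp hn'.2 hn₀' with h | h
    · left; exact ⟨hn'.1, by exact_mod_cast h⟩
    · right; refine ⟨hn'.1, ?_⟩; push_cast; rwa [sub_neg_eq_add]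
  calc T.card ≤ _ := Finset.card_le_card hsub
    _ ≤ _ := Finset.card_union_le _ _
    _ ≤ (X / p ^ 2 + 1) + (X / p ^ 2 + 1) :=
        add_le_add (card_filter_Icc_modEq_le _ X _) (card_filter_Icc_modEq_le _ X _)
    _ = 2 * (X / p ^ 2 + 1) := by ring

/-- **Iwaniec 1978, §2 p. 173 — PROVED (with an explicit constant).**  "The number of those
`a ∈ 𝒜`, `(a, P(z)) = 1`, which are not squarefree, is less than
`∑_{z ≤ p < x} |𝒜_{p²}| ≪ ∑_{z ≤ p < x} (1 + x p⁻²) ≪ x z^{−1/2}`": here, for `x ≥ 1`, `z ≥ 2`,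
`#{1 ≤ n ≤ x : (n² + 1, P(z)) = 1, n² + 1 not squarefree} ≤ 7 x / √z`.  (If `p² ∣ n² + 1` with
all prime factors of `n² + 1` at least `z`, then `p² z ≤ n² + 1 ≤ 2x²`, so `p ≤ x √(2/z)`; then
`card_filter_sq_dvd_le` and `∑_{p ≥ z} p⁻² ≤ 2/z`.) [cite: IwaniecInventiones1978, §2 p. 173] -/
theorem card_nonSquarefree_le {x z : ℝ} (hx : 1 ≤ x) (hz : 2 ≤ z) :
    ((((Finset.Icc 1 ⌊x⌋₊).filter fun n : ℕ =>
        Nat.Coprime (n ^ 2 + 1) (primesProdBelow z) ∧ ¬ Squarefree (n ^ 2 + 1))).card : ℝ) ≤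
      7 * x / Real.sqrt z := by
  set X := ⌊x⌋₊ with hX
  set N := (Finset.Icc 1 X).filter fun n : ℕ =>
        Nat.Coprime (n ^ 2 + 1) (primesProdBelow z) ∧ ¬ Squarefree (n ^ 2 + 1) with hN
  set B := ⌊x * Real.sqrt (2 / z)⌋₊ with hB
  set S := (Finset.Icc ⌈z⌉₊ B).filter Nat.Prime with hS
  have hz0 : 0 < z := by linarith
  have hx0 : 0 < x := by linarith
  have hXx : (X : ℝ) ≤ x := Nat.floor_le hx0.le
  -- Step 1: `N` is covered by the progressions `p² ∣ n² + 1`, `p ∈ S`.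
  have hcover : N ⊆ S.biUnion fun p => (Finset.Icc 1 X).filter fun n : ℕ => p ^ 2 ∣ n ^ 2 + 1 := by
    intro n hn
    rw [Finset.mem_filter, Finset.mem_Icc] at hn
    obtain ⟨⟨hn1, hnX⟩, hcop, hnsf⟩ := hn
    rw [Nat.squarefree_iff_prime_squarefree] at hnsf
    simp only [not_forall, not_not] at hnsf
    obtain ⟨p, hp, hpp⟩ := hnsf
    have hge : ∀ q : ℕ, q.Prime → q ∣ n ^ 2 + 1 → z ≤ q := by
      intro q hq hqd
      by_contra hlt
      rw [not_le] at hlt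
      have hqP : q ∣ primesProdBelow z := (dvd_primesProdBelow_iff hq z).mpr hlt
      have hq1 : q ∣ Nat.gcd (n ^ 2 + 1) (primesProdBelow z) := Nat.dvd_gcd hqd hqP
      rw [hcop.gcd_eq_one] at hq1
      exact hq.one_lt.ne' (Nat.dvd_one.mp hq1)
    have hpz : z ≤ p := hge p hp (dvd_trans (dvd_mul_right p p) hpp)
    rw [Finset.mem_biUnion]
    refine ⟨p, ?_, ?_⟩
    · rw [Finset.mem_filter, Finset.mem_Icc]
      refine ⟨⟨Nat.ceil_le.mpr hpz, ?_⟩, hp⟩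
      obtain ⟨l, hl⟩ := hpp
      have hl1 : l ≠ 1 := by
        intro hl1
        rw [hl1, mul_one] at hl
        have hnp : n < p := by nlinarith
        nlinarith
      have hl0 : l ≠ 0 := by
        intro h0
        rw [h0, mul_zero] at hl
        omega
      have hlz : z ≤ l := by
        have hml : (l.minFac).Prime := Nat.minFac_prime hl1
        have hmd : l.minFac ∣ n ^ 2 + 1 := hl ▸ dvd_mul_of_dvd_right (Nat.minFac_dvd l) _
        exact (hge _ hml hmd).trans (by exact_mod_cast Nat.minFac_le (Nat.pos_of_ne_zero hl0))
      have h1 : (p : ℝ) * p * z ≤ (n : ℝ) ^ 2 + 1 := by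
        have e : ((n ^ 2 + 1 : ℕ) : ℝ) = (p : ℝ) * p * l := by exact_mod_cast hl
        push_cast at e
        rw [e]
        exact mul_le_mul_of_nonneg_left hlz (by positivity)
      have hnx : (n : ℝ) ≤ x := le_trans (by exact_mod_cast hnX) hXx
      have h2 : (n : ℝ) ^ 2 + 1 ≤ 2 * x ^ 2 := by nlinarith
      apply Nat.le_floor
      have hrhs : 0 ≤ x * Real.sqrt (2 / z) := by positivity
      refine (pow_le_pow_iff_left₀ (by positivity) hrhs two_ne_zero).mp ?_
      rw [mul_pow, Real.sq_sqrt (by positivity), mul_div_assoc', le_div_iff₀ hz0]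
      nlinarith [h1, h2]
    · rw [Finset.mem_filter, Finset.mem_Icc]
      exact ⟨⟨hn1, hnX⟩, (sq p).symm ▸ hpp⟩
  -- Step 2: count.
  have hcard : (N.card : ℝ) ≤ ∑ p ∈ S, 2 * ((X : ℝ) / (p : ℝ) ^ 2 + 1) := by
    have h1 : N.card ≤ ∑ p ∈ S, 2 * (X / p ^ 2 + 1) :=
      calc N.card ≤ (S.biUnion fun p => (Finset.Icc 1 X).filter
              fun n : ℕ => p ^ 2 ∣ n ^ 2 + 1).card := Finset.card_le_card hcover
        _ ≤ ∑ p ∈ S, ((Finset.Icc 1 X).filter fun n : ℕ => p ^ 2 ∣ n ^ 2 + 1).card :=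
            Finset.card_biUnion_le
        _ ≤ ∑ p ∈ S, 2 * (X / p ^ 2 + 1) :=
            Finset.sum_le_sum fun p hp => card_filter_sq_dvd_le (Finset.mem_filter.mp hp).2 X
    have h2 : ((∑ p ∈ S, 2 * (X / p ^ 2 + 1) : ℕ) : ℝ) ≤
        ∑ p ∈ S, 2 * ((X : ℝ) / (p : ℝ) ^ 2 + 1) := by
      push_cast
      refine Finset.sum_le_sum fun p _ => ?_
      gcongr
      rw [← Nat.cast_pow]
      exact Nat.cast_div_le
    exact le_trans (by exact_mod_cast h1) h2
  -- Step 3: evaluate the sum: `∑_{p ∈ S} p⁻² ≤ 2/z` and `#S ≤ B ≤ x √(2/z)`.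
  have hceil2 : 2 ≤ ⌈z⌉₊ := by
    have : (2 : ℝ) ≤ ⌈z⌉₊ := hz.trans (Nat.le_ceil z)
    exact_mod_cast this
  set k := ⌈z⌉₊ - 1 with hk
  have hk0 : k ≠ 0 := by omega
  have hkz : z / 2 ≤ (k : ℝ) := by
    have h1 : (k : ℝ) = (⌈z⌉₊ : ℝ) - 1 := by
      rw [hk, Nat.cast_sub (by omega : 1 ≤ ⌈z⌉₊), Nat.cast_one]
    rw [h1]
    have := Nat.le_ceil z
    linarith
  have hsumS : ∑ p ∈ S, ((p : ℝ) ^ 2)⁻¹ ≤ 2 / z := by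
    have hsub : S ⊆ Finset.Ioc k (max k B) := by
      intro p hp
      rw [Finset.mem_filter, Finset.mem_Icc] at hp
      rw [Finset.mem_Ioc]
      exact ⟨by omega, le_max_of_le_right hp.1.2⟩
    calc ∑ p ∈ S, ((p : ℝ) ^ 2)⁻¹ ≤ ∑ i ∈ Finset.Ioc k (max k B), ((i : ℝ) ^ 2)⁻¹ :=
          Finset.sum_le_sum_of_subset_of_nonneg hsub fun i _ _ => by positivity
      _ ≤ (k : ℝ)⁻¹ - ((max k B : ℕ) : ℝ)⁻¹ := sum_Ioc_inv_sq_le_sub hk0 (le_max_left k B)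
      _ ≤ (k : ℝ)⁻¹ := by
          have : (0 : ℝ) ≤ ((max k B : ℕ) : ℝ)⁻¹ := by positivity
          linarith
      _ ≤ (z / 2)⁻¹ := inv_anti₀ (by positivity) hkz
      _ = 2 / z := inv_div z 2
  have hcardS : (S.card : ℝ) ≤ x * Real.sqrt (2 / z) := by
    have h1 : S.card ≤ B := by
      calc S.card ≤ (Finset.Icc ⌈z⌉₊ B).card := Finset.card_filter_le _ _
        _ = B + 1 - ⌈z⌉₊ := Nat.card_Icc _ _
        _ ≤ B := by omega
    calc (S.card : ℝ) ≤ B := by exact_mod_cast h1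
      _ ≤ x * Real.sqrt (2 / z) := Nat.floor_le (by positivity)
  have hsum_eq : ∑ p ∈ S, 2 * ((X : ℝ) / (p : ℝ) ^ 2 + 1) =
      2 * (X : ℝ) * ∑ p ∈ S, ((p : ℝ) ^ 2)⁻¹ + 2 * S.card := by
    have h : ∀ p ∈ S, 2 * ((X : ℝ) / (p : ℝ) ^ 2 + 1) = 2 * (X : ℝ) * ((p : ℝ) ^ 2)⁻¹ + 2 :=
      fun p _ => by ring
    rw [Finset.sum_congr rfl h, Finset.sum_add_distrib, Finset.sum_const, ← Finset.mul_sum,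
      nsmul_eq_mul, mul_comm (S.card : ℝ) 2]
  -- Step 4: numerics, `4X/z + 2x√(2/z) ≤ 7x/√z`.
  set s := Real.sqrt z with hs
  have hs0 : 0 < s := Real.sqrt_pos.mpr hz0
  have hs2 : s ^ 2 = z := Real.sq_sqrt hz0.le
  have hsz : s ≤ z := by nlinarith
  have hsq2 : Real.sqrt (2 / z) = Real.sqrt 2 / s := Real.sqrt_div (by norm_num) z
  have h22 : 2 * Real.sqrt 2 ≤ 3 := by
    nlinarith [Real.sq_sqrt (show (0 : ℝ) ≤ 2 by norm_num), Real.sqrt_nonneg 2]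
  have hp1 : 2 * (X : ℝ) * ∑ p ∈ S, ((p : ℝ) ^ 2)⁻¹ ≤ 4 * x / s := by
    calc 2 * (X : ℝ) * ∑ p ∈ S, ((p : ℝ) ^ 2)⁻¹ ≤ 2 * x * (2 / z) := by
          gcongr
      _ = 4 * x / z := by ring
      _ ≤ 4 * x / s := div_le_div_of_nonneg_left (by positivity) hs0 hsz
  have hp2 : 2 * (S.card : ℝ) ≤ 3 * x / s := by
    calc 2 * (S.card : ℝ) ≤ 2 * (x * Real.sqrt (2 / z)) := by gcongr
      _ = (2 * Real.sqrt 2) * x / s := by rw [hsq2]; ring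
      _ ≤ 3 * x / s := by gcongr
  calc (N.card : ℝ) ≤ _ := hcard
    _ = _ := hsum_eq
    _ ≤ 4 * x / s + 3 * x / s := add_le_add hp1 hp2
    _ = 7 * x / s := by ring

/-- **Iwaniec 1978, p. 173, `#{a ∈ 𝒜 : a = P₂} ≥ W*(𝒜, z)` — PROVED, in the form used for
parity.S19.**  For `x > 1`, `z ≥ 2` and any finite set `T ⊇ {n : Ω(n² + 1) ≤ 2}`:
`W(𝒜, z) ≤ #T + 1 + 7x/√z`.  (Each weight is `≤ 1`; a positive weight at `a = n² + 1 ≤ x²`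
forces `ω(a) ≤ 2` by Lemma 1 with `λ = 2` — the single `n = ⌊x⌋`, for which `n² + 1 > x²` is
possible, is discarded — and then either `a` is squarefree, so `Ω(a) = ω(a) ≤ 2`, or `a` is counted
by `card_nonSquarefree_le`.) [cite: IwaniecInventiones1978, §2 p. 173] -/
theorem weightedSum_le_card (T : Finset ℕ)
    (hT : ∀ n : ℕ, Nat.IsAtMostAlmostPrime 2 (n ^ 2 + 1) → n ∈ T) {x z : ℝ} (hx : 1 < x)
    (hz : 2 ≤ z) : weightedSum x z ≤ T.card + 1 + 7 * x / Real.sqrt z := by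
  unfold weightedSum
  set F := (Finset.Icc 1 ⌊x⌋₊).filter (fun n : ℕ => Nat.Coprime (n ^ 2 + 1) (primesProdBelow z))
    with hF
  set N := (Finset.Icc 1 ⌊x⌋₊).filter fun n : ℕ =>
      Nat.Coprime (n ^ 2 + 1) (primesProdBelow z) ∧ ¬ Squarefree (n ^ 2 + 1) with hN
  have hNle : (N.card : ℝ) ≤ 7 * x / Real.sqrt z := card_nonSquarefree_le hx.le hz
  set F₂ := F.filter fun n : ℕ => 0 < richertWeight 2 x (n ^ 2 + 1) with hF₂
  have h1 : ∑ n ∈ F, richertWeight 2 x (n ^ 2 + 1) ≤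
      ∑ n ∈ F, (if 0 < richertWeight 2 x (n ^ 2 + 1) then (1 : ℝ) else 0) := by
    refine Finset.sum_le_sum fun n _ => ?_
    split_ifs with h
    · exact richertWeight_le_one (by norm_num) hx _
    · exact not_lt.mp h
  have h2 : ∑ n ∈ F, (if 0 < richertWeight 2 x (n ^ 2 + 1) then (1 : ℝ) else 0) = F₂.card := by
    rw [Finset.sum_boole]
  have hx0 : 0 < x := by linarith
  have h3 : F₂ ⊆ insert ⌊x⌋₊ (T ∪ N) := by
    intro n hn
    rw [hF₂, hF, Finset.mem_filter, Finset.mem_filter, Finset.mem_Icc] at hn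
    obtain ⟨⟨⟨hn1, hnx⟩, hcop⟩, hw⟩ := hn
    rw [Finset.mem_insert, Finset.mem_union]
    rcases eq_or_ne n ⌊x⌋₊ with h | hne
    · exact Or.inl h
    right
    have hnlt : n < ⌊x⌋₊ := lt_of_le_of_ne hnx hne
    have hle : ((n ^ 2 + 1 : ℕ) : ℝ) ≤ x ^ (2 : ℝ) := by
      rw [Real.rpow_two]
      have h' : (n : ℝ) + 1 ≤ x := by
        have h1' : ((n + 1 : ℕ) : ℝ) ≤ ⌊x⌋₊ := by exact_mod_cast hnlt
        have hfl : (⌊x⌋₊ : ℝ) ≤ x := Nat.floor_le hx0.le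
        push_cast at h1'
        linarith
      have hn0 : (0 : ℝ) ≤ n := Nat.cast_nonneg n
      push_cast
      nlinarith
    have hω := cardDistinctFactors_le_two_of_richertWeight_pos (lam := 2) le_rfl (by norm_num) hx
      (Nat.succ_ne_zero _) hle hw
    by_cases hsf : Squarefree (n ^ 2 + 1)
    · left
      apply hT
      refine ⟨Nat.succ_ne_zero _, ?_⟩
      rw [← (ArithmeticFunction.cardDistinctFactors_eq_cardFactors_iff_squarefree
        (Nat.succ_ne_zero _)).mpr hsf]
      exact hω
    · right
      rw [hN, Finset.mem_filter, Finset.mem_Icc]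
      exact ⟨⟨hn1, hnx⟩, hcop, hsf⟩
  have h4 : (F₂.card : ℝ) ≤ T.card + N.card + 1 := by
    have : F₂.card ≤ T.card + N.card + 1 :=
      calc F₂.card ≤ (insert ⌊x⌋₊ (T ∪ N)).card := Finset.card_le_card h3
        _ ≤ (T ∪ N).card + 1 := Finset.card_insert_le _ _
        _ ≤ T.card + N.card + 1 := by gcongr; exact Finset.card_union_le _ _
    exact_mod_cast this
  calc ∑ n ∈ F, richertWeight 2 x (n ^ 2 + 1) ≤ F₂.card := h1.trans_eq h2
    _ ≤ T.card + N.card + 1 := h4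
    _ ≤ T.card + 1 + 7 * x / Real.sqrt z := by linarith

/-- The real-variable inequality behind `(2) ⟹ parity.S19`: with `u = x^{1/10}`, `L = log x ≤ δu`,
`δ = c / (2(7 + K))`, one has `K + 7u¹⁰/u ≤ c u¹⁰ / L`. [folklore] -/
theorem key_ineq_of_log_le {K c δ u L : ℝ} (hK : 0 ≤ K) (hc : 0 < c)
    (hδ : δ = c / (2 * (7 + K))) (hu : 1 ≤ u) (hL0 : 0 < L) (hL : L ≤ δ * u) :
    K + 7 * u ^ 10 / u ≤ c * u ^ 10 / L := by
  rw [le_div_iff₀ hL0]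
  have hu0 : 0 < u := by linarith
  have hδ0 : 0 ≤ δ := by rw [hδ]; positivity
  rw [show 7 * u ^ 10 / u = 7 * u ^ 9 by field_simp]
  have h9 : 1 ≤ u ^ 9 := one_le_pow₀ hu
  calc (K + 7 * u ^ 9) * L ≤ (K + 7 * u ^ 9) * (δ * u) := by gcongr
    _ ≤ (K * u ^ 9 + 7 * u ^ 9) * (δ * u) := by gcongr; nlinarith
    _ = (7 + K) * δ * u ^ 10 := by ring
    _ = c / 2 * u ^ 10 := by rw [hδ]; field_simp
    _ ≤ c * u ^ 10 := by nlinarith [pow_pos hu0 10]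

/-- **Iwaniec 1978, reduction of the Theorem to (2) (p. 173) — PROVED.**  Iwaniec's
weighted-sieve inequality (2) (p. 173) at `z = x^{1/5}` (`weightedSum_lower`, the content of
§§3–6) implies that `Ω(n² + 1) ≤ 2` for
infinitely many `n` (`Literature.NumberTheory.Sieve.setOf_isAtMostAlmostPrime_two_sq_add_one_infinite`): otherwise
`weightedSum_le_card` bounds `W(𝒜, x^{1/5}) ≤ K + 7x^{9/10}` with `K` constant, contradicting
`W(𝒜, x^{1/5}) > (Γ/77) x / log x`, `Γ > 0` (`gamma_pos`), since `log x = o(x^{1/10})`.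
[cite: IwaniecInventiones1978, §2 p. 173] -/
theorem setOf_isAtMostAlmostPrime_two_sq_add_one_infinite_of_weightedSum_lower
    (h : weightedSum_lower) : setOf_isAtMostAlmostPrime_two_sq_add_one_infinite := by
  intro hfin
  set T := hfin.toFinset with hTdef
  have hT : ∀ n : ℕ, Nat.IsAtMostAlmostPrime 2 (n ^ 2 + 1) → n ∈ T := fun n hn =>
    hfin.mem_toFinset.mpr hn
  set c : ℝ := gamma / 77 with hc
  have hc0 : 0 < c := div_pos gamma_pos (by norm_num)
  set K : ℝ := T.card + 1 with hK
  have hK0 : 0 ≤ K := by positivity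
  set δ : ℝ := c / (2 * (7 + K)) with hδ
  have hδ0 : 0 < δ := by positivity
  have hlog : ∀ᶠ x : ℝ in atTop, ‖Real.log x‖ ≤ δ * ‖x ^ (1 / 10 : ℝ)‖ :=
    (Asymptotics.isLittleO_iff.mp (isLittleO_log_rpow_atTop (by norm_num : (0 : ℝ) < 1 / 10))) hδ0
  obtain ⟨x, hx32, hlogx, hWx⟩ := ((eventually_ge_atTop (32 : ℝ)).and (hlog.and h)).exists
  have hx1 : 1 < x := by linarith
  have hx0 : 0 < x := by linarith
  set u : ℝ := x ^ (1 / 10 : ℝ) with hu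
  have hu1 : 1 ≤ u := Real.one_le_rpow hx1.le (by norm_num)
  have hxu : u ^ 10 = x := by
    rw [hu, ← Real.rpow_mul_natCast hx0.le]; norm_num
  have hz2 : x ^ (1 / 5 : ℝ) = u ^ 2 := by
    rw [hu, ← Real.rpow_mul_natCast hx0.le]; norm_num
  have hsqrt : Real.sqrt (x ^ (1 / 5 : ℝ)) = u := by
    rw [hz2, Real.sqrt_sq (by positivity)]
  have h2z : (2 : ℝ) ≤ x ^ (1 / 5 : ℝ) := by
    rw [one_div, Real.le_rpow_inv_iff_of_pos (by norm_num) hx0.le (by norm_num)]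
    norm_num; linarith
  have hLx : Real.log x ≤ δ * u := by
    rw [Real.norm_eq_abs, Real.norm_eq_abs, abs_of_nonneg (Real.log_nonneg hx1.le),
      abs_of_nonneg (Real.rpow_nonneg hx0.le _)] at hlogx
    exact hlogx
  have hL0 : 0 < Real.log x := Real.log_pos hx1
  have hW := weightedSum_le_card T hT hx1 h2z
  rw [hsqrt] at hW
  have hkey := key_ineq_of_log_le (K := K) (c := c) hK0 hc0 hδ hu1 hL0 hLx
  rw [hxu] at hkey
  have : (T.card : ℝ) + 1 + 7 * x / u ≤ gamma / 77 * x / Real.log x := by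
    have e : (T.card : ℝ) + 1 + 7 * x / u = K + 7 * x / u := by rw [hK]
    rw [e]; exact hkey
  linarith

/-! ### §2, identity (3) (p. 174): `W(𝒜, z)` in terms of sifting functions — PROVED

`W(𝒜, z) = S(𝒜, z) − ∑_{z ≤ p < x} ∑_{a ∈ 𝒜_p, (a, P(z)) = 1} ω_p(a)` (p. 174, first display;
`weightedSum_eq_card_sub`), the evaluation of the inner sums through the least prime factor of
`a` (second display), Buchstab's identity `∑_{z ≤ p₁ < p} S(𝒜_{pp₁}, p₁) = S(𝒜_p, z) − S(𝒜_p, p)`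
(`siftedCount_buchstab`), and the resulting identity (3) (`weightedSum_eq`).  The printed (3)
carries the factor `log(p₁/p)` in the double sum; the derivation (and its use on p. 186, where the
double sum enters with `(u − t) f(…) ≥ 0`) shows it must read `log(p/p₁)`, which is what we
prove. -/

/-- `(m, P(u)) = 1` iff every prime factor of `m` is `≥ u`. [folklore] -/
theorem coprime_primesProdBelow_iff_forall (m : ℕ) (u : ℝ) :
    m.Coprime (primesProdBelow u) ↔ ∀ q : ℕ, q.Prime → q ∣ m → u ≤ (q : ℝ) := by
  rw [coprime_primesProdBelow_iff]
  constructor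
  · intro h q hq hqm
    by_contra hlt
    rw [not_le] at hlt
    exact h q (Nat.mem_primesBelow.mpr ⟨Nat.lt_ceil.mpr hlt, hq⟩) hqm
  · intro h q hq hqm
    rw [Nat.mem_primesBelow] at hq
    exact absurd (Nat.lt_ceil.mp hq.1) (not_lt.mpr (h q hq.2 hqm))

/-- For `m ≠ 1`: `(m, P(u)) = 1` iff the least prime factor of `m` is `≥ u`. [folklore] -/
theorem coprime_primesProdBelow_iff_le_minFac {m : ℕ} (hm : m ≠ 1) (u : ℝ) :
    m.Coprime (primesProdBelow u) ↔ u ≤ (m.minFac : ℝ) := by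
  rw [coprime_primesProdBelow_iff_forall]
  constructor
  · intro h
    exact h _ (Nat.minFac_prime hm) (Nat.minFac_dvd m)
  · intro h q hq hqm
    exact h.trans (by exact_mod_cast Nat.minFac_le_of_dvd hq.two_le hqm)

/-- The primes `p` with `a ≤ p < b` (`a, b` real), the index ranges of (3). [folklore] -/
def primesIn (a b : ℝ) : Finset ℕ :=
  (Finset.range ⌈b⌉₊).filter fun p : ℕ => p.Prime ∧ a ≤ (p : ℝ)

/-- Membership in `primesIn a b`. [folklore] -/
theorem mem_primesIn {a b : ℝ} {p : ℕ} :
    p ∈ primesIn a b ↔ p.Prime ∧ a ≤ (p : ℝ) ∧ (p : ℝ) < b := by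
  rw [primesIn, Finset.mem_filter, Finset.mem_range]
  constructor
  · rintro ⟨h1, h2, h3⟩; exact ⟨h2, h3, Nat.lt_ceil.mp h1⟩
  · rintro ⟨h1, h2, h3⟩; exact ⟨Nat.lt_ceil.mpr h3, h1, h2⟩

section Identity3

variable {x z : ℝ}

/-- The index set of `{a ∈ 𝒜 : (a, P(z)) = 1}`: `{1 ≤ n ≤ x : (n² + 1, P(z)) = 1}`.
[cite: IwaniecInventiones1978, §2 p. 173] -/
def siftedSet (x z : ℝ) : Finset ℕ :=
  (Finset.Icc 1 ⌊x⌋₊).filter (fun n : ℕ => Nat.Coprime (n ^ 2 + 1) (primesProdBelow z))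

/-- `S(𝒜, z) = S(𝒜_1, z) = #siftedSet`. [folklore] -/
theorem siftedCount_one (x z : ℝ) : siftedCount x 1 z = (siftedSet x z).card := by
  unfold siftedCount siftedSet
  congr 1
  exact Finset.filter_congr fun n _ => by simp

/-- **p. 174, first display — PROVED:**
`W(𝒜, z) = S(𝒜, z) − ∑_{z ≤ p < x} ∑_{a ∈ 𝒜_p, (a, P(z)) = 1} ω_p(a)` (at `λ = 2`).
[cite: IwaniecInventiones1978, §2 p. 174] -/
theorem weightedSum_eq_card_sub (x z : ℝ) :
    weightedSum x z = (siftedCount x 1 z : ℝ) -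
      ∑ p ∈ primesIn z x, ∑ n ∈ (siftedSet x z).filter (fun n : ℕ => p ∣ n ^ 2 + 1),
        omegaWeight x (n ^ 2 + 1) p := by
  rw [siftedCount_one]
  unfold weightedSum richertWeight
  rw [show (Finset.Icc 1 ⌊x⌋₊).filter (fun n : ℕ => Nat.Coprime (n ^ 2 + 1) (primesProdBelow z)) =
    siftedSet x z from rfl]
  rw [Finset.sum_sub_distrib, Finset.sum_const, nsmul_eq_mul, mul_one]
  congr 1
  simp only [show (3 : ℝ) - 2 = 1 by norm_num, inv_one, one_mul]
  -- exchange the order of summation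
  refine Finset.sum_comm' fun n p => ?_
  simp only [Finset.mem_filter, mem_primesIn, siftedSet]
  constructor
  · rintro ⟨⟨hn, hcop⟩, hp, hpx⟩
    have hpp := Nat.prime_of_mem_primeFactors hp
    have hpd := Nat.dvd_of_mem_primeFactors hp
    exact ⟨⟨⟨hn, hcop⟩, hpd⟩, hpp, (coprime_primesProdBelow_iff_forall _ _).mp hcop p hpp hpd, hpx⟩
  · rintro ⟨⟨⟨hn, hcop⟩, hpd⟩, hpp, _, hpx⟩
    exact ⟨⟨hn, hcop⟩, Nat.mem_primeFactors.mpr ⟨hpp, hpd, Nat.succ_ne_zero _⟩, hpx⟩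


/-- `n² + 1 ≠ 1` for `n ≥ 1`. [folklore] -/
theorem sq_add_one_ne_one {n : ℕ} (hn : 1 ≤ n) : n ^ 2 + 1 ≠ 1 := by
  have : 1 ≤ n ^ 2 := Nat.one_le_pow _ _ hn
  omega

/-- Membership in `siftedSet`. [folklore] -/
theorem mem_siftedSet {n : ℕ} : n ∈ siftedSet x z ↔
    n ∈ Finset.Icc 1 ⌊x⌋₊ ∧ Nat.Coprime (n ^ 2 + 1) (primesProdBelow z) := Finset.mem_filter

/-- `{a ∈ 𝒜_p : (a, P(z)) = 1}` is the set counted by `S(𝒜_p, z)`. [folklore] -/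
theorem filter_dvd_siftedSet (p : ℕ) :
    (siftedSet x z).filter (fun n : ℕ => p ∣ n ^ 2 + 1) =
      (Finset.Icc 1 ⌊x⌋₊).filter fun n : ℕ =>
        p ∣ n ^ 2 + 1 ∧ Nat.Coprime (n ^ 2 + 1) (primesProdBelow z) := by
  unfold siftedSet
  rw [Finset.filter_filter]
  exact Finset.filter_congr fun n _ => and_comm

/-- The elements of `𝒜_p` sifted by `P(z)` whose least prime factor is `p` (`p ≥ z` prime) are
exactly those of `𝒜_p` sifted by `P(p)` (p. 174). [cite: IwaniecInventiones1978, §2 p. 174] -/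
theorem filter_minFac_eq_self {p : ℕ} (hp : p.Prime) (hzp : z ≤ (p : ℝ)) :
    (siftedSet x z).filter (fun n : ℕ => p ∣ n ^ 2 + 1 ∧ (n ^ 2 + 1).minFac = p) =
      (Finset.Icc 1 ⌊x⌋₊).filter fun n : ℕ =>
        p ∣ n ^ 2 + 1 ∧ Nat.Coprime (n ^ 2 + 1) (primesProdBelow p) := by
  unfold siftedSet
  rw [Finset.filter_filter]
  refine Finset.filter_congr fun n hn => ?_
  rw [Finset.mem_Icc] at hn
  have h1 : n ^ 2 + 1 ≠ 1 := sq_add_one_ne_one hn.1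
  rw [coprime_primesProdBelow_iff_le_minFac h1, coprime_primesProdBelow_iff_le_minFac h1]
  constructor
  · rintro ⟨_, hpd, hmin⟩
    exact ⟨hpd, by rw [hmin]⟩
  · rintro ⟨hpd, hle⟩
    have hle' : p ≤ (n ^ 2 + 1).minFac := by exact_mod_cast hle
    have hge : (n ^ 2 + 1).minFac ≤ p := Nat.minFac_le_of_dvd hp.two_le hpd
    have heq : (n ^ 2 + 1).minFac = p := le_antisymm hge hle'
    exact ⟨by rw [heq]; exact hzp, hpd, heq⟩

/-- The elements of `𝒜_p` sifted by `P(z)` whose least prime factor is `p₁`, `z ≤ p₁ < p`, are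
exactly those of `𝒜_{pp₁}` sifted by `P(p₁)` (p. 174). [cite: IwaniecInventiones1978, §2 p. 174] -/
theorem filter_minFac_eq_of_lt {p p₁ : ℕ} (hp : p.Prime) (hp₁ : p₁.Prime) (hlt : p₁ < p)
    (hzp : z ≤ (p₁ : ℝ)) :
    (siftedSet x z).filter (fun n : ℕ => p ∣ n ^ 2 + 1 ∧ (n ^ 2 + 1).minFac = p₁) =
      (Finset.Icc 1 ⌊x⌋₊).filter fun n : ℕ =>
        p * p₁ ∣ n ^ 2 + 1 ∧ Nat.Coprime (n ^ 2 + 1) (primesProdBelow p₁) := by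
  unfold siftedSet
  rw [Finset.filter_filter]
  refine Finset.filter_congr fun n hn => ?_
  rw [Finset.mem_Icc] at hn
  have h1 : n ^ 2 + 1 ≠ 1 := sq_add_one_ne_one hn.1
  have hcop : Nat.Coprime p p₁ := (Nat.coprime_primes hp hp₁).mpr hlt.ne'
  rw [coprime_primesProdBelow_iff_le_minFac h1, coprime_primesProdBelow_iff_le_minFac h1]
  constructor
  · rintro ⟨_, hpd, hmin⟩
    refine ⟨hcop.mul_dvd_of_dvd_of_dvd hpd (hmin ▸ Nat.minFac_dvd _), by rw [hmin]⟩
  · rintro ⟨hpd, hle⟩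
    have hpd' : p ∣ n ^ 2 + 1 := dvd_trans (dvd_mul_right p p₁) hpd
    have hp₁d : p₁ ∣ n ^ 2 + 1 := dvd_trans (dvd_mul_left p₁ p) hpd
    have hle' : p₁ ≤ (n ^ 2 + 1).minFac := by exact_mod_cast hle
    have hge : (n ^ 2 + 1).minFac ≤ p₁ := Nat.minFac_le_of_dvd hp₁.two_le hp₁d
    have heq : (n ^ 2 + 1).minFac = p₁ := le_antisymm hge hle'
    exact ⟨by rw [heq]; exact hzp, hpd', heq⟩

/-- **Buchstab's identity (p. 174) — PROVED:** for a prime `p ≥ z`,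
`S(𝒜_p, z) = S(𝒜_p, p) + ∑_{z ≤ p₁ < p} S(𝒜_{pp₁}, p₁)` (split `𝒜_p ∩ {(a, P(z)) = 1}` by the
least prime factor of `a`). [cite: IwaniecInventiones1978, §2 p. 174] -/
theorem siftedCount_buchstab {p : ℕ} (hp : p.Prime) (hzp : z ≤ (p : ℝ)) :
    (siftedCount x p z : ℝ) = siftedCount x p p +
      ∑ p₁ ∈ primesIn z p, (siftedCount x (p * p₁) p₁ : ℝ) := by
  have hsplit := (Finset.card_filter_add_card_filter_not
    (s := (siftedSet x z).filter (fun n : ℕ => p ∣ n ^ 2 + 1))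
    (fun n : ℕ => (n ^ 2 + 1).minFac = p))
  rw [Finset.filter_filter, Finset.filter_filter, filter_minFac_eq_self hp hzp,
    filter_dvd_siftedSet] at hsplit
  unfold siftedCount
  rw [← hsplit, Nat.cast_add]
  congr 1
  -- the part with `minFac ≠ p`, fibred over `p₁ = minFac`
  rw [Finset.card_eq_sum_card_fiberwise (f := fun n : ℕ => (n ^ 2 + 1).minFac)
    (t := primesIn z p) ?_]
  · push_cast
    refine Finset.sum_congr rfl fun p₁ hp₁ => ?_
    rw [mem_primesIn] at hp₁
    have hlt : p₁ < p := by exact_mod_cast hp₁.2.2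
    rw [Finset.filter_filter, ← filter_minFac_eq_of_lt hp hp₁.1 hlt hp₁.2.1]
    congr 2
    refine Finset.filter_congr fun n _ => ⟨fun h => ⟨h.1.1, h.2⟩, fun h => ⟨⟨h.1, ?_⟩, h.2⟩⟩
    rw [h.2]; exact hlt.ne
  · intro n hn
    rw [Finset.mem_coe, Finset.mem_filter, mem_siftedSet, Finset.mem_Icc] at hn
    obtain ⟨⟨hn1, hcop⟩, hpd, hne⟩ := hn
    have h1 : n ^ 2 + 1 ≠ 1 := sq_add_one_ne_one hn1.1
    rw [Finset.mem_coe, mem_primesIn]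
    refine ⟨Nat.minFac_prime h1, (coprime_primesProdBelow_iff_le_minFac h1 z).mp hcop, ?_⟩
    exact_mod_cast lt_of_le_of_ne (Nat.minFac_le_of_dvd hp.two_le hpd) hne

/-- For `p ≥ x^{1/2}`: `∑_{a ∈ 𝒜_p, (a,P(z))=1} ω_p(a) = (1 − log p/log x) S(𝒜_p, z)` (p. 174,
third term of the second display). [cite: IwaniecInventiones1978, §2 p. 174] -/
theorem sum_omegaWeight_of_sqrt_le {p : ℕ} (hpx : ¬ (p : ℝ) < x ^ (1 / 2 : ℝ)) :
    ∑ n ∈ (siftedSet x z).filter (fun n : ℕ => p ∣ n ^ 2 + 1), omegaWeight x (n ^ 2 + 1) p =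
      (1 - Real.log p / Real.log x) * siftedCount x p z := by
  rw [Finset.sum_congr rfl fun n _ => show omegaWeight x (n ^ 2 + 1) p =
      1 - Real.log p / Real.log x by
        unfold omegaWeight; split_ifs <;> rfl,
    Finset.sum_const, nsmul_eq_mul, mul_comm, filter_dvd_siftedSet]
  rfl

/-- For `z ≤ p < x^{1/2}`: `∑_{a ∈ 𝒜_p, (a,P(z))=1} ω_p(a)
= (1 − log p/log x) S(𝒜_p, p) + ∑_{z ≤ p₁ < p} (log p₁/log x) S(𝒜_{pp₁}, p₁)` (p. 174, first two
terms of the second display). [cite: IwaniecInventiones1978, §2 p. 174] -/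
theorem sum_omegaWeight_of_lt_sqrt {p : ℕ} (hp : p.Prime) (hzp : z ≤ (p : ℝ))
    (hpx : (p : ℝ) < x ^ (1 / 2 : ℝ)) :
    ∑ n ∈ (siftedSet x z).filter (fun n : ℕ => p ∣ n ^ 2 + 1), omegaWeight x (n ^ 2 + 1) p =
      (1 - Real.log p / Real.log x) * siftedCount x p p +
        ∑ p₁ ∈ primesIn z p, Real.log p₁ / Real.log x * siftedCount x (p * p₁) p₁ := by
  rw [← Finset.sum_filter_add_sum_filter_not _ (fun n : ℕ => (n ^ 2 + 1).minFac = p)]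
  congr 1
  · -- least prime factor `p`
    rw [Finset.sum_congr rfl fun n hn => show omegaWeight x (n ^ 2 + 1) p =
        1 - Real.log p / Real.log x by
          rw [Finset.mem_filter] at hn
          unfold omegaWeight; rw [if_pos hn.2.symm],
      Finset.sum_const, nsmul_eq_mul, mul_comm, Finset.filter_filter, filter_minFac_eq_self hp hzp]
    rfl
  · -- least prime factor `p₁ < p`
    rw [Finset.sum_congr rfl fun n hn => show omegaWeight x (n ^ 2 + 1) p =
        Real.log (n ^ 2 + 1).minFac / Real.log x by
          rw [Finset.mem_filter] at hn
          unfold omegaWeight; rw [if_neg (Ne.symm hn.2), if_pos hpx]]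
    rw [← Finset.sum_fiberwise_of_maps_to (g := fun n : ℕ => (n ^ 2 + 1).minFac)
      (t := primesIn z p) ?_]
    · refine Finset.sum_congr rfl fun p₁ hp₁ => ?_
      rw [mem_primesIn] at hp₁
      have hlt : p₁ < p := by exact_mod_cast hp₁.2.2
      rw [Finset.sum_congr rfl fun n hn => show Real.log ((n ^ 2 + 1).minFac : ℕ) / Real.log x =
          Real.log p₁ / Real.log x by rw [(Finset.mem_filter.mp hn).2],
        Finset.sum_const, nsmul_eq_mul, mul_comm]
      congr 1
      unfold siftedCount
      rw [← filter_minFac_eq_of_lt hp hp₁.1 hlt hp₁.2.1, Finset.filter_filter, Finset.filter_filter]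
      congr 2
      refine Finset.filter_congr fun n _ => ⟨fun h => ⟨h.1, h.2.2⟩, fun h => ⟨h.1, ?_, h.2⟩⟩
      rw [h.2]; exact hlt.ne
    · intro n hn
      rw [Finset.mem_filter, Finset.mem_filter, mem_siftedSet, Finset.mem_Icc] at hn
      obtain ⟨⟨⟨hn1, hcop⟩, hpd⟩, hne⟩ := hn
      have h1 : n ^ 2 + 1 ≠ 1 := sq_add_one_ne_one hn1.1
      rw [mem_primesIn]
      refine ⟨Nat.minFac_prime h1, (coprime_primesProdBelow_iff_le_minFac h1 z).mp hcop, ?_⟩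
      exact_mod_cast lt_of_le_of_ne (Nat.minFac_le_of_dvd hp.two_le hpd) hne


/-- `{z ≤ p < x} ∩ {p < x^{1/2}} = {z ≤ p < x^{1/2}}` for `x ≥ 1`. [folklore] -/
theorem primesIn_filter_lt (hx : 1 ≤ x) (z : ℝ) :
    (primesIn z x).filter (fun p : ℕ => (p : ℝ) < x ^ (1 / 2 : ℝ)) =
      primesIn z (x ^ (1 / 2 : ℝ)) := by
  ext p
  simp only [Finset.mem_filter, mem_primesIn]
  have hsx : x ^ (1 / 2 : ℝ) ≤ x := Real.rpow_le_self_of_one_le hx (by norm_num)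
  constructor
  · rintro ⟨⟨hp, hzp, _⟩, hlt⟩; exact ⟨hp, hzp, hlt⟩
  · rintro ⟨hp, hzp, hlt⟩; exact ⟨⟨hp, hzp, hlt.trans_le hsx⟩, hlt⟩

/-- `{z ≤ p < x} ∩ {x^{1/2} ≤ p} = {x^{1/2} ≤ p < x}` for `z ≤ x^{1/2}`. [folklore] -/
theorem primesIn_filter_not_lt (hz : z ≤ x ^ (1 / 2 : ℝ)) :
    (primesIn z x).filter (fun p : ℕ => ¬ (p : ℝ) < x ^ (1 / 2 : ℝ)) =
      primesIn (x ^ (1 / 2 : ℝ)) x := by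
  ext p
  simp only [Finset.mem_filter, mem_primesIn, not_lt]
  constructor
  · rintro ⟨⟨hp, _, hpx⟩, hle⟩; exact ⟨hp, hle, hpx⟩
  · rintro ⟨hp, hle, hpx⟩; exact ⟨⟨hp, hz.trans hle, hpx⟩, hle⟩

/-- **Iwaniec 1978, (3) p. 174 — PROVED** (with the sign of the double sum corrected: the
printed `log(p₁/p)` should read `log(p/p₁)`, as used on p. 186). For `x ≥ 1` and `z ≤ x^{1/2}`,
`W(𝒜, z) = S(𝒜, z) + ∑∑_{z ≤ p₁ < p < x^{1/2}} (log(p/p₁)/log x) S(𝒜_{pp₁}, p₁)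
  − ∑_{z ≤ p < x^{1/2}} {(1 − 2 log p/log x) S(𝒜_p, p) + (log p/log x) S(𝒜_p, z)}
  − ∑_{x^{1/2} ≤ p < x} (1 − log p/log x) S(𝒜_p, z)`.
[cite: IwaniecInventiones1978, §2 (3) p. 174] -/
theorem weightedSum_eq (hx : 1 ≤ x) (hz : z ≤ x ^ (1 / 2 : ℝ)) :
    weightedSum x z =
      (siftedCount x 1 z : ℝ)
      + ∑ p ∈ primesIn z (x ^ (1 / 2 : ℝ)), ∑ p₁ ∈ primesIn z p,
          Real.log ((p : ℝ) / p₁) / Real.log x * (siftedCount x (p * p₁) p₁ : ℝ)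
      - ∑ p ∈ primesIn z (x ^ (1 / 2 : ℝ)),
          ((1 - 2 * Real.log p / Real.log x) * (siftedCount x p p : ℝ)
            + Real.log p / Real.log x * (siftedCount x p z : ℝ))
      - ∑ p ∈ primesIn (x ^ (1 / 2 : ℝ)) x,
          (1 - Real.log p / Real.log x) * (siftedCount x p z : ℝ) := by
  rw [weightedSum_eq_card_sub x z,
    ← Finset.sum_filter_add_sum_filter_not (primesIn z x) (fun p : ℕ => (p : ℝ) < x ^ (1 / 2 : ℝ)),
    primesIn_filter_lt hx, primesIn_filter_not_lt hz]
  -- the range `x^{1/2} ≤ p < x`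
  rw [Finset.sum_congr rfl fun p hp => sum_omegaWeight_of_sqrt_le (x := x) (z := z)
    (not_lt.mpr (mem_primesIn.mp hp).2.1)]
  -- the range `z ≤ p < x^{1/2}`
  rw [Finset.sum_congr rfl fun p hp => sum_omegaWeight_of_lt_sqrt (x := x) (z := z)
    (mem_primesIn.mp hp).1 (mem_primesIn.mp hp).2.1 (mem_primesIn.mp hp).2.2]
  have key : ∀ p ∈ primesIn z (x ^ (1 / 2 : ℝ)),
      (1 - Real.log p / Real.log x) * (siftedCount x p p : ℝ) +
          ∑ p₁ ∈ primesIn z p, Real.log p₁ / Real.log x * (siftedCount x (p * p₁) p₁ : ℝ) =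
        ((1 - 2 * Real.log p / Real.log x) * (siftedCount x p p : ℝ)
            + Real.log p / Real.log x * (siftedCount x p z : ℝ)) -
          ∑ p₁ ∈ primesIn z p,
            Real.log ((p : ℝ) / p₁) / Real.log x * (siftedCount x (p * p₁) p₁ : ℝ) := by
    intro p hp
    rw [mem_primesIn] at hp
    have hp0 : (p : ℝ) ≠ 0 := by exact_mod_cast hp.1.ne_zero
    rw [siftedCount_buchstab hp.1 hp.2.1, mul_add, Finset.mul_sum]
    have e1 : ∑ p₁ ∈ primesIn z p, Real.log p / Real.log x * (siftedCount x (p * p₁) p₁ : ℝ) -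
        ∑ p₁ ∈ primesIn z p,
          Real.log ((p : ℝ) / p₁) / Real.log x * (siftedCount x (p * p₁) p₁ : ℝ) -
        ∑ p₁ ∈ primesIn z p, Real.log p₁ / Real.log x * (siftedCount x (p * p₁) p₁ : ℝ) = 0 := by
      rw [← Finset.sum_sub_distrib, ← Finset.sum_sub_distrib]
      refine Finset.sum_eq_zero fun p₁ hp₁ => ?_
      rw [Real.log_div hp0 (by exact_mod_cast (mem_primesIn.mp hp₁).1.ne_zero)]
      ring
    linear_combination (-1 : ℝ) * e1
  rw [Finset.sum_congr rfl key, Finset.sum_sub_distrib]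
  ring

end Identity3

/-! ### §3. Lemma 2: the linear sieve with Iwaniec's bilinear remainder term — named fact -/

/-- The Jurkat–Richert functions `F, f` of the linear sieve as characterised in Lemma 2 (p. 175):
the continuous solutions on `(0, ∞)` of `s f(s) = 0` (`0 < s ≤ 2`), `s F(s) = 2e^C` (`0 < s ≤ 3`),
`(s f(s))' = F(s − 1)` (`s > 2`), `(s F(s))' = f(s − 1)` (`s > 3`), `C` Euler's constant.  (These
determine `F, f` uniquely by forward stepping; cf. `Literature.IsBetaSieveSolution 1 F f 2 (2e^C)` of
`SieveFunctions.lean`, which implies this predicate: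
`IsLinearSieveFunctions.of_isBetaSieveSolution`.)
[cite: IwaniecInventiones1978, Lemma 2] -/
structure IsLinearSieveFunctions (F f : ℝ → ℝ) : Prop where
  /-- `F` is continuous on `(0, ∞)`. -/
  continuousOn_upper : ContinuousOn F (Set.Ioi 0)
  /-- `f` is continuous on `(0, ∞)`. -/
  continuousOn_lower : ContinuousOn f (Set.Ioi 0)
  /-- `s F(s) = 2 e^C` for `0 < s ≤ 3`. -/
  upper_eq : ∀ s : ℝ, 0 < s → s ≤ 3 → s * F s = 2 * Real.exp Real.eulerMascheroniConstant
  /-- `s f(s) = 0` for `0 < s ≤ 2`. -/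
  lower_eq : ∀ s : ℝ, 0 < s → s ≤ 2 → s * f s = 0
  /-- `(s F(s))' = f(s − 1)` for `s > 3`. -/
  hasDerivAt_upper : ∀ s : ℝ, 3 < s → HasDerivAt (fun t : ℝ => t * F t) (f (s - 1)) s
  /-- `(s f(s))' = F(s − 1)` for `s > 2`. -/
  hasDerivAt_lower : ∀ s : ℝ, 2 < s → HasDerivAt (fun t : ℝ => t * f t) (F (s - 1)) s

/-- A normalised `β`-sieve solution of dimension `1` with `β = 2`, `A = 2e^C` (the data of
`SieveFunctions.lean`) satisfies Iwaniec's characterisation. [folklore] -/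
theorem IsLinearSieveFunctions.of_isBetaSieveSolution {F f : ℝ → ℝ}
    (h : IsBetaSieveSolution 1 F f 2 (2 * Real.exp Real.eulerMascheroniConstant)) :
    IsLinearSieveFunctions F f where
  continuousOn_upper := h.continuousOn_upper
  continuousOn_lower := h.continuousOn_lower
  upper_eq s hs0 hs3 := by
    rw [h.upper_eq s ⟨hs0, by norm_num; exact hs3⟩, Real.rpow_neg_one]
    field_simp
  lower_eq s hs0 hs2 := by rw [h.lower_eq s ⟨hs0, hs2⟩, mul_zero]
  hasDerivAt_upper s hs := by
    have h1 := h.hasDerivAt_upper s (by norm_num; exact hs)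
    simp only [Real.rpow_one, one_mul, sub_self, Real.rpow_zero] at h1
    exact h1
  hasDerivAt_lower s hs := by
    have h1 := h.hasDerivAt_lower s hs
    simp only [Real.rpow_one, one_mul, sub_self, Real.rpow_zero] at h1
    exact h1

/-! ### §6, p. 187: the sieve functions beyond the elementary ranges — PROVED

From `IsLinearSieveFunctions` alone: `F(s) = A/s` (`0 < s ≤ 3`), `f(s) = 0` (`0 < s ≤ 2`),
`s f(s) = A log(s − 1)` (`2 ≤ s ≤ 4`), and the two displayed formulas of p. 187 for `s F(s)` on
`[3, 5]` and `s f(s)` on `[4, 6]` (`A = 2e^C`), each by the mean value theorem from the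
delay-differential equations and the fundamental theorem of calculus. These are the values of
`F`, `f` entering the numerical evaluation of `W` (p. 186) at `α = 16/15`, `γ = 1/5`. -/

/-- The constant `A = 2e^C` of the linear sieve (`C` = Euler's constant), p. 175.
[cite: IwaniecInventiones1978, Lemma 2] -/
def sieveA : ℝ := 2 * Real.exp Real.eulerMascheroniConstant

/-- `I(w) = ∫_2^w log(u − 1) du/u`, the integral through which `F` on `[3, 5]` and `f` on `[4, 6]`
are expressed on p. 187. [cite: IwaniecInventiones1978, §6 p. 187] -/
def logInt (w : ℝ) : ℝ := ∫ u in (2 : ℝ)..w, Real.log (u - 1) / u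

/-- A uniqueness step (mean value theorem): if `Q`, `G` are continuous on `[a, b]`, have the same
derivative on the open interval `(a, b)` and agree at `a`, then they agree at `b`. [folklore] -/
theorem eq_of_hasDerivAt_eq_Ioo {Q G q : ℝ → ℝ} {a b : ℝ} (hab : a ≤ b)
    (hQc : ContinuousOn Q (Set.Icc a b)) (hGc : ContinuousOn G (Set.Icc a b))
    (hQ : ∀ t ∈ Set.Ioo a b, HasDerivAt Q (q t) t) (hG : ∀ t ∈ Set.Ioo a b, HasDerivAt G (q t) t)
    (h0 : Q a = G a) : Q b = G b := by
  rcases hab.eq_or_lt with rfl | hlt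
  · exact h0
  have hD : ∀ t ∈ Set.Ioo a b, HasDerivAt (fun t => Q t - G t) (q t - q t) t :=
    fun t ht => (hQ t ht).sub (hG t ht)
  obtain ⟨c, _, hc'⟩ := exists_hasDerivAt_eq_slope (fun t => Q t - G t) (fun t => q t - q t)
    hlt (hQc.sub hGc) hD
  rw [sub_self, eq_comm, div_eq_zero_iff] at hc'
  rcases hc' with h | h
  · linarith
  · exact absurd (sub_eq_zero.mp h) hlt.ne'

/-- `t ↦ log(t − 1)` is continuous on `(1, ∞)`. [folklore] -/
theorem continuousOn_log_sub_one : ContinuousOn (fun t : ℝ => Real.log (t - 1)) (Set.Ioi 1) :=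
  (continuous_sub_right (1 : ℝ)).continuousOn.log fun t ht => by
    simp only [Set.mem_Ioi] at ht; exact (sub_pos.mpr ht).ne'

/-- `(log(t − 1))' = 1/(t − 1)` for `t > 1`. [folklore] -/
theorem hasDerivAt_log_sub_one {t : ℝ} (ht : 1 < t) :
    HasDerivAt (fun t : ℝ => Real.log (t - 1)) (1 / (t - 1)) t := by
  have h := ((hasDerivAt_id t).sub_const 1).log (sub_pos.mpr ht).ne'
  simp only [id, one_div] at h
  rw [one_div]
  exact h

/-- `u ↦ log(u − 1)/u` is continuous on `(1, ∞)`. [folklore] -/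
theorem continuousOn_logInt_integrand :
    ContinuousOn (fun u : ℝ => Real.log (u - 1) / u) (Set.Ioi 1) :=
  continuousOn_log_sub_one.div continuousOn_id fun u hu => by
    simp only [Set.mem_Ioi] at hu
    exact (by linarith : (0 : ℝ) < u).ne'

/-- `I'(w) = log(w − 1)/w` for `w > 1` (fundamental theorem of calculus). [folklore] -/
theorem hasDerivAt_logInt {w : ℝ} (hw : 1 < w) :
    HasDerivAt logInt (Real.log (w - 1) / w) w := by
  unfold logInt
  have hcont := continuousOn_logInt_integrand
  refine intervalIntegral.integral_hasDerivAt_right ?_ ?_ ?_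
  · refine (hcont.mono ?_).intervalIntegrable
    intro u hu
    simp only [Set.mem_Ioi]
    rcases le_total 2 w with h2 | h2
    · rw [Set.uIcc_of_le h2] at hu; linarith [hu.1]
    · rw [Set.uIcc_of_ge h2] at hu; linarith [hu.1]
  · exact hcont.stronglyMeasurableAtFilter isOpen_Ioi _ hw
  · exact hcont.continuousAt (isOpen_Ioi.mem_nhds hw)

/-- `t ↦ I(t − 1)` has derivative `log(t − 2)/(t − 1)` at `t > 2`. [folklore] -/
theorem hasDerivAt_logInt_sub_one {t : ℝ} (ht : 2 < t) :
    HasDerivAt (fun t : ℝ => logInt (t - 1)) (Real.log (t - 2) / (t - 1)) t := by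
  have h := (hasDerivAt_logInt (w := t - 1) (by linarith)).comp t ((hasDerivAt_id t).sub_const 1)
  refine (h.congr_deriv ?_)
  rw [show t - 1 - 1 = t - 2 by ring, mul_one]

namespace IsLinearSieveFunctions

variable {F f : ℝ → ℝ}

/-- `F(s) = A/s` for `0 < s ≤ 3`. [cite: IwaniecInventiones1978, Lemma 2] -/
theorem upper_eq_div (h : IsLinearSieveFunctions F f) {s : ℝ} (hs0 : 0 < s) (hs3 : s ≤ 3) :
    F s = sieveA / s := by
  rw [eq_div_iff hs0.ne', mul_comm]; exact h.upper_eq s hs0 hs3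

/-- `f(s) = 0` for `0 < s ≤ 2`. [cite: IwaniecInventiones1978, Lemma 2] -/
theorem lower_eq_zero (h : IsLinearSieveFunctions F f) {s : ℝ} (hs0 : 0 < s) (hs2 : s ≤ 2) :
    f s = 0 := by
  have := h.lower_eq s hs0 hs2
  rcases mul_eq_zero.mp this with h0 | h0
  · exact absurd h0 hs0.ne'
  · exact h0

/-- `t ↦ t f(t)` is continuous on `[a, b]`, `a > 0`. [folklore] -/
theorem continuousOn_mul_lower (h : IsLinearSieveFunctions F f) {a b : ℝ} (ha : 0 < a) :
    ContinuousOn (fun t : ℝ => t * f t) (Set.Icc a b) :=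
  continuousOn_id.mul (h.continuousOn_lower.mono fun t ht => by
    simp only [Set.mem_Ioi]; exact ha.trans_le ht.1)

/-- `t ↦ t F(t)` is continuous on `[a, b]`, `a > 0`. [folklore] -/
theorem continuousOn_mul_upper (h : IsLinearSieveFunctions F f) {a b : ℝ} (ha : 0 < a) :
    ContinuousOn (fun t : ℝ => t * F t) (Set.Icc a b) :=
  continuousOn_id.mul (h.continuousOn_upper.mono fun t ht => by
    simp only [Set.mem_Ioi]; exact ha.trans_le ht.1)

/-- `s f(s) = A log(s − 1)` for `2 ≤ s ≤ 4` — PROVED from the delay-differential system (the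
"elementary range" of `f`, p. 187). [cite: IwaniecInventiones1978, §6 p. 187] -/
theorem mul_lower_eq (h : IsLinearSieveFunctions F f) {s : ℝ} (hs2 : 2 ≤ s) (hs4 : s ≤ 4) :
    s * f s = sieveA * Real.log (s - 1) := by
  refine eq_of_hasDerivAt_eq_Ioo (Q := fun t => t * f t) (G := fun t => sieveA * Real.log (t - 1))
    (q := fun t => sieveA / (t - 1)) hs2 (h.continuousOn_mul_lower two_pos) ?_ ?_ ?_ ?_
  · exact continuousOn_const.mul (continuousOn_log_sub_one.mono fun t ht => by
      simp only [Set.mem_Ioi]; linarith [ht.1])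
  · intro t ht
    have h1 := h.hasDerivAt_lower t ht.1
    rwa [h.upper_eq_div (by linarith [ht.1]) (by linarith [ht.2])] at h1
  · intro t ht
    have h1 := (hasDerivAt_log_sub_one (t := t) (by linarith [ht.1])).const_mul sieveA
    exact h1.congr_deriv (by field_simp)
  · show 2 * f 2 = sieveA * Real.log (2 - 1)
    rw [h.lower_eq 2 two_pos le_rfl]; norm_num

/-- `f(s) = A log(s − 1)/s` for `2 ≤ s ≤ 4`. [cite: IwaniecInventiones1978, §6 p. 187] -/
theorem lower_eq_log_div (h : IsLinearSieveFunctions F f) {s : ℝ} (hs2 : 2 ≤ s) (hs4 : s ≤ 4) :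
    f s = sieveA * Real.log (s - 1) / s := by
  rw [eq_div_iff (by linarith), mul_comm]; exact h.mul_lower_eq hs2 hs4

/-- **p. 187, first display — PROVED:** `s F(s) = 2e^C {1 + ∫_2^{s−1} log(u − 1) du/u}` for
`3 ≤ s ≤ 5`. [cite: IwaniecInventiones1978, §6 p. 187] -/
theorem mul_upper_eq (h : IsLinearSieveFunctions F f) {s : ℝ} (hs3 : 3 ≤ s) (hs5 : s ≤ 5) :
    s * F s = sieveA * (1 + logInt (s - 1)) := by
  have hG : ∀ t : ℝ, 2 < t → HasDerivAt (fun t : ℝ => sieveA * (1 + logInt (t - 1)))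
      (sieveA * (Real.log (t - 2) / (t - 1))) t := fun t ht =>
    ((hasDerivAt_logInt_sub_one ht).const_add 1).const_mul sieveA
  refine eq_of_hasDerivAt_eq_Ioo (Q := fun t => t * F t)
    (G := fun t => sieveA * (1 + logInt (t - 1)))
    (q := fun t => sieveA * (Real.log (t - 2) / (t - 1))) hs3 (h.continuousOn_mul_upper three_pos)
    ?_ ?_ ?_ ?_
  · exact fun t ht => (hG t (by linarith [ht.1])).continuousAt.continuousWithinAt
  · intro t ht
    have h1 := h.hasDerivAt_upper t ht.1
    rw [h.lower_eq_log_div (by linarith [ht.1]) (by linarith [ht.2])] at h1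
    refine h1.congr_deriv ?_
    rw [show t - 1 - 1 = t - 2 by ring]; ring
  · exact fun t ht => hG t (by linarith [ht.1])
  · show 3 * F 3 = sieveA * (1 + logInt (3 - 1))
    rw [show (3 : ℝ) - 1 = 2 by norm_num, logInt, intervalIntegral.integral_same, add_zero, mul_one]
    exact h.upper_eq 3 three_pos le_rfl

/-- `F(s) = A (1 + I(s − 1))/s` for `3 ≤ s ≤ 5`. [cite: IwaniecInventiones1978, §6 p. 187] -/
theorem upper_eq_logInt_div (h : IsLinearSieveFunctions F f) {s : ℝ} (hs3 : 3 ≤ s)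
    (hs5 : s ≤ 5) : F s = sieveA * (1 + logInt (s - 1)) / s := by
  rw [eq_div_iff (by linarith), mul_comm]; exact h.mul_upper_eq hs3 hs5

/-- `t ↦ I(t − 1)/t` is continuous on `(2, ∞)`. [folklore] -/
theorem continuousOn_logInt_sub_one_div :
    ContinuousOn (fun t : ℝ => logInt (t - 1) / t) (Set.Ioi 2) := by
  intro t ht
  simp only [Set.mem_Ioi] at ht
  exact ((hasDerivAt_logInt_sub_one ht).continuousAt.div continuousAt_id
    (by simp only [id]; linarith)).continuousWithinAt

/-- The primitive `v ↦ ∫_3^v I(r − 1) dr/r` has derivative `I(v − 1)/v` at `v > 2`. [folklore] -/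
theorem hasDerivAt_primitive_logInt {v : ℝ} (hv : 2 < v) :
    HasDerivAt (fun v : ℝ => ∫ r in (3 : ℝ)..v, logInt (r - 1) / r) (logInt (v - 1) / v) v := by
  have hcont := continuousOn_logInt_sub_one_div
  refine intervalIntegral.integral_hasDerivAt_right ?_ ?_ ?_
  · refine (hcont.mono fun r hr => ?_).intervalIntegrable
    simp only [Set.mem_Ioi]
    rcases le_total 3 v with h3 | h3
    · rw [Set.uIcc_of_le h3] at hr; linarith [hr.1]
    · rw [Set.uIcc_of_ge h3] at hr; linarith [hr.1]
  · exact hcont.stronglyMeasurableAtFilter isOpen_Ioi _ hv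
  · exact hcont.continuousAt (isOpen_Ioi.mem_nhds hv)

/-- **p. 187, second display — PROVED:**
`s f(s) = 2e^C {log(s − 1) + ∫_3^{s−1} ∫_2^{t−1} log(u − 1) du/u dt/t}` for `4 ≤ s ≤ 6`.
[cite: IwaniecInventiones1978, §6 p. 187] -/
theorem mul_lower_eq_of_le_six (h : IsLinearSieveFunctions F f) {s : ℝ} (hs4 : 4 ≤ s)
    (hs6 : s ≤ 6) :
    s * f s = sieveA * (Real.log (s - 1) + ∫ t in (3 : ℝ)..(s - 1), logInt (t - 1) / t) := by
  have hG : ∀ t : ℝ, 3 < t → HasDerivAt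
      (fun t : ℝ => sieveA * (Real.log (t - 1) + ∫ r in (3 : ℝ)..(t - 1), logInt (r - 1) / r))
      (sieveA * (1 / (t - 1) + logInt (t - 2) / (t - 1))) t := fun t ht => by
    have h1 := hasDerivAt_log_sub_one (t := t) (by linarith)
    have h2 := (hasDerivAt_primitive_logInt (v := t - 1) (by linarith)).comp t
      ((hasDerivAt_id t).sub_const 1)
    have h3 := (h1.add h2).const_mul sieveA
    refine h3.congr_deriv ?_
    rw [show t - 1 - 1 = t - 2 by ring, mul_one]
  refine eq_of_hasDerivAt_eq_Ioo (Q := fun t => t * f t)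
    (G := fun t => sieveA * (Real.log (t - 1) + ∫ r in (3 : ℝ)..(t - 1), logInt (r - 1) / r))
    (q := fun t => sieveA * (1 / (t - 1) + logInt (t - 2) / (t - 1))) hs4
    (h.continuousOn_mul_lower four_pos) ?_ ?_ ?_ ?_
  · exact fun t ht => (hG t (by linarith [ht.1])).continuousAt.continuousWithinAt
  · intro t ht
    have h1 := h.hasDerivAt_lower t (by linarith [ht.1])
    rw [h.upper_eq_logInt_div (by linarith [ht.1]) (by linarith [ht.2])] at h1
    refine h1.congr_deriv ?_
    rw [show t - 1 - 1 = t - 2 by ring]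
    field_simp
  · exact fun t ht => hG t (by linarith [ht.1])
  · show 4 * f 4 = sieveA * (Real.log (4 - 1) + ∫ r in (3 : ℝ)..(4 - 1), logInt (r - 1) / r)
    rw [show (4 : ℝ) - 1 = 3 by norm_num, intervalIntegral.integral_same, add_zero,
      h.mul_lower_eq (s := 4) (by norm_num) le_rfl]
    norm_num

/-- `f(s)` for `4 ≤ s ≤ 6`. [cite: IwaniecInventiones1978, §6 p. 187] -/
theorem lower_eq_of_le_six (h : IsLinearSieveFunctions F f) {s : ℝ} (hs4 : 4 ≤ s) (hs6 : s ≤ 6) :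
    f s = sieveA * (Real.log (s - 1) + ∫ t in (3 : ℝ)..(s - 1), logInt (t - 1) / t) / s := by
  rw [eq_div_iff (by linarith), mul_comm]; exact h.mul_lower_eq_of_le_six hs4 hs6

/-! #### Regularity: `t F(t)` and `F` are `C¹` on `(0, ∞)` (gluing at `s = 3`, where `f(2) = 0`)

Needed to convert the prime sums of §6 into integrals by partial summation (the weights
`(1 − 2u) F((α − u)/u) γ/u`, `u F((α − u)/γ)`, `(1 − u) F((α − u)/γ)` of p. 186 must be `C¹`). -/

/-- The derivative of `t ↦ t F(t)` on `(0, ∞)`: `0` for `t ≤ 3`, `f(t − 1)` for `t > 3`.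
[cite: IwaniecInventiones1978, Lemma 2] -/
def mulUpperDeriv (f : ℝ → ℝ) (t : ℝ) : ℝ := if t ≤ 3 then 0 else f (t - 1)

/-- `mulUpperDeriv f` is continuous on `(0, ∞)` (at `t = 3` both sides give `f(2) = 0`).
[folklore] -/
theorem continuousOn_mulUpperDeriv (h : IsLinearSieveFunctions F f) :
    ContinuousOn (mulUpperDeriv f) (Set.Ioi 0) := by
  intro t ht
  simp only [Set.mem_Ioi] at ht
  rcases lt_trichotomy t 3 with hlt | rfl | hgt
  · -- locally `0`
    have hev : (mulUpperDeriv f) =ᶠ[𝓝 t] fun _ => 0 := by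
      filter_upwards [Iio_mem_nhds hlt] with y hy
      simp only [mulUpperDeriv, if_pos (Set.mem_Iio.mp hy).le]
    exact (continuousAt_const.congr_of_eventuallyEq hev).continuousWithinAt
  · -- at `3`: both one-sided limits are `0 = f(2)`
    have hf2 : f 2 = 0 := h.lower_eq_zero two_pos le_rfl
    have hfc : ContinuousAt (fun y : ℝ => f (y - 1)) 3 := by
      have h1 : ContinuousAt f 2 := h.continuousOn_lower.continuousAt (Ioi_mem_nhds two_pos)
      have h2 : ContinuousAt (fun y : ℝ => y - 1) 3 := (continuous_sub_right (1 : ℝ)).continuousAt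
      exact ContinuousAt.comp_of_eq h1 h2 (by norm_num)
    refine ContinuousAt.continuousWithinAt ?_
    rw [ContinuousAt, show mulUpperDeriv f 3 = 0 by simp [mulUpperDeriv]]
    have hfc0 : Tendsto (fun y : ℝ => f (y - 1)) (𝓝 3) (𝓝 0) := by
      have := hfc.tendsto; norm_num [hf2] at this; exact this
    refine (tendsto_order.2 ⟨fun a ha => ?_, fun a ha => ?_⟩)
    · filter_upwards [(tendsto_order.1 hfc0).1 a ha] with y hy
      unfold mulUpperDeriv; split_ifs
      · exact ha
      · exact hy
    · filter_upwards [(tendsto_order.1 hfc0).2 a ha] with y hy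
      unfold mulUpperDeriv; split_ifs
      · exact ha
      · exact hy
  · -- locally `f(t-1)`
    have hev : (mulUpperDeriv f) =ᶠ[𝓝 t] fun y => f (y - 1) := by
      filter_upwards [Ioi_mem_nhds hgt] with y hy
      simp only [mulUpperDeriv, if_neg (not_le.mpr (Set.mem_Ioi.mp hy))]
    have hfc : ContinuousAt (fun y : ℝ => f (y - 1)) t := by
      have h1 : ContinuousAt f (t - 1) :=
        h.continuousOn_lower.continuousAt (Ioi_mem_nhds (by linarith))
      exact ContinuousAt.comp_of_eq h1 ((continuous_sub_right (1 : ℝ)).continuousAt) rfl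
    exact (hfc.congr_of_eventuallyEq hev).continuousWithinAt

/-- `t ↦ t F(t)` is differentiable on all of `(0, ∞)` with derivative `mulUpperDeriv f t` (in
particular at `t = 3`, where the delay equation starts, the derivative is `f(2) = 0`; proof by
gluing through an auxiliary function constant `= A` left of `3`). [folklore] -/
theorem hasDerivAt_mul_upper (h : IsLinearSieveFunctions F f) {t : ℝ} (ht : 0 < t) :
    HasDerivAt (fun y : ℝ => y * F y) (mulUpperDeriv f t) t := by
  -- auxiliary function, constant `A` left of `3`
  set P : ℝ → ℝ := fun y => if y ≤ 3 then sieveA else y * F y with hP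
  have hPeq : ∀ y : ℝ, 0 < y → P y = y * F y := by
    intro y hy
    simp only [hP]
    split_ifs with h3
    · exact (h.upper_eq y hy h3).symm
    · rfl
  have hPd : ∀ y : ℝ, y ≠ 3 → HasDerivAt P (mulUpperDeriv f y) y := by
    intro y hy
    rcases lt_or_gt_of_ne hy with hlt | hgt
    · have hev : P =ᶠ[𝓝 y] fun _ => sieveA := by
        filter_upwards [Iio_mem_nhds hlt] with w hw
        simp only [hP, if_pos (Set.mem_Iio.mp hw).le]
      rw [mulUpperDeriv, if_pos hlt.le]
      exact (hasDerivAt_const y sieveA).congr_of_eventuallyEq hev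
    · have hev : P =ᶠ[𝓝 y] fun w => w * F w := by
        filter_upwards [Ioi_mem_nhds hgt] with w hw
        simp only [hP, if_neg (not_le.mpr (Set.mem_Ioi.mp hw))]
      rw [mulUpperDeriv, if_neg (not_le.mpr hgt)]
      exact (h.hasDerivAt_upper y hgt).congr_of_eventuallyEq hev
  have hP3 : HasDerivAt P (mulUpperDeriv f 3) 3 := by
    refine hasDerivAt_of_hasDerivAt_of_ne hPd ?_ ?_
    · -- continuity of `P` at `3`
      have hc : ContinuousAt (fun y : ℝ => y * F y) 3 :=
        (h.continuousOn_mul_upper (a := 1) (b := 4) one_pos).continuousAt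
          (Icc_mem_nhds (by norm_num) (by norm_num))
      have hev : P =ᶠ[𝓝 3] fun y => y * F y := by
        filter_upwards [Ioi_mem_nhds (show (0 : ℝ) < 3 by norm_num)] with y hy using hPeq y hy
      exact hc.congr_of_eventuallyEq hev
    · exact (continuousOn_mulUpperDeriv h).continuousAt (Ioi_mem_nhds three_pos)
  have hPt : HasDerivAt P (mulUpperDeriv f t) t := by
    rcases eq_or_ne t 3 with rfl | hne
    · exact hP3
    · exact hPd t hne
  have hev : P =ᶠ[𝓝 t] fun y => y * F y := by
    filter_upwards [Ioi_mem_nhds ht] with y hy using hPeq y hy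
  exact hPt.congr_of_eventuallyEq hev.symm

/-- `F` is differentiable on `(0, ∞)` with `F'(t) = (mulUpperDeriv f t − F(t))/t`. [folklore] -/
theorem hasDerivAt_upper' (h : IsLinearSieveFunctions F f) {t : ℝ} (ht : 0 < t) :
    HasDerivAt F ((mulUpperDeriv f t - F t) / t) t := by
  have h1 := (hasDerivAt_mul_upper h ht).div (hasDerivAt_id t) ht.ne'
  have hev : ((fun y : ℝ => y * F y) / id) =ᶠ[𝓝 t] F := by
    filter_upwards [Ioi_mem_nhds ht] with y hy
    have hy0 : y ≠ 0 := ne_of_gt hy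
    simp only [Pi.div_apply, id]
    field_simp
  refine (h1.congr_of_eventuallyEq hev.symm).congr_deriv ?_
  simp only [id, mul_one]
  field_simp

/-- `F'` is continuous on `(0, ∞)`: `F` is `C¹` there. [folklore] -/
theorem continuousOn_upperDeriv (h : IsLinearSieveFunctions F f) :
    ContinuousOn (fun t : ℝ => (mulUpperDeriv f t - F t) / t) (Set.Ioi 0) :=
  ((continuousOn_mulUpperDeriv h).sub h.continuousOn_upper).div continuousOn_id
    fun _ ht => (ne_of_gt ht)

end IsLinearSieveFunctions

/-- `|ℬ_d| = #{b ∈ ℬ : b ≡ 0 (mod d)}` for a finite sequence of integers `ℬ` (a multiset), p. 174.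
[cite: IwaniecInventiones1978, §3 p. 174] -/
def mcount (B : Multiset ℤ) (d : ℕ) : ℕ :=
  (B.filter fun b : ℤ => (d : ℤ) ∣ b).card

/-- `S(ℬ, z) = #{b ∈ ℬ : (b, P(z)) = 1}` for a finite sequence of integers `ℬ`, p. 174 / [11] §1.
[cite: IwaniecActaArith1980b, §1] -/
def msifted (B : Multiset ℤ) (z : ℝ) : ℕ :=
  (B.filter fun b : ℤ => Int.gcd b (primesProdBelow z) = 1).card

/-- **Iwaniec 1978, Lemma 2 (p. 175) = the linear sieve with the bilinear form of the remainder
term [11]**, vendored in its published form [cite: IwaniecActaArith1980b, Theorem 1] (Acta Arith. 37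
(1980), p. 309, with conditions (1), (2) of p. 308 and all primes as sifting set).  Let `ℬ` be a
finite sequence of integers, `X > 0`, `ω` multiplicative with `0 ≤ ω(p) < p`, and suppose for all
`2 ≤ w < z`: (1) `∏_{w ≤ p < z} (1 − ω(p)/p)⁻¹ ≤ (log z / log w)(1 + K / log w)` and
(2) `∑_{w ≤ p < z} ∑_{a ≥ 2} ω(p^a)/p^a ≤ L / log 3w`, with constants `K, L ≥ 1`.  Let
`0 < ε < 1/3`, `M > 1`, `N > 1`, `D = MN`.  Then for `2 ≤ z ≤ D^{1/2}`,
`S(ℬ, z) ≤ V(z) X {F(s) + E} + R⁺`, `S(ℬ, z) ≥ V(z) X {f(s) − E} − R⁻`, where `s = log D / log z`,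
`V(z) = ∏_{p<z} (1 − ω(p)/p)`, `E ≪ ε + ε⁻⁸ e^{K+L} (log D)^{−1/3}` (absolute constant), and
`R^± = ∑_{l < exp(8ε⁻³)} ∑_{m < M} ∑_{n < N, mn ∣ P(z)} a^±_{m,l} b^±_{n,l} r(ℬ, mn)` with
`r(ℬ, d) = |ℬ_d| − (ω(d)/d) X` and coefficients bounded by `1` in absolute value depending at most
on `M, N, ε` (and `l`) — in particular NOT on `ℬ`, `X`, `ω`, `z`; "moreover (7), (8) remain true
if `m, n` in the remainder term are assumed to satisfy `mn ∣ P(z)`" (p. 309), the form used here.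
(The paper takes `K, L > 1`; allowing `K, L ≥ 1` only changes the absolute constant `c₀`, since
(1), (2) with `K, L` imply them with `K + 1, L + 1`.  The printed number of bilinear forms is
`#{l : 1 ≤ l < exp(8ε⁻³)}`; `Finset.range L` with `L ≤ exp(8ε⁻³)` may be one form more generous —
harmless.)  NOTE for Proposition 2: the published theorem requires `z ≤ (MN)^{1/2}`, i.e. `s ≥ 2`,
whereas Prop. 2 is applied with `s = log(y/q)/log z_q` as small as `2/15 + 2ε`; for `s < 2` the
upper bound is recovered from the case `z' = (MN)^{1/2}` by the monotonicity
`S(ℬ, z) ≤ S(ℬ, z')` (`z' ≤ z`) — so `lemma2_bilinearSieve` alone does not give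
`proposition2_upper` verbatim; that extra step belongs to the Prop. 2 session.
Discrepancy note: the 1978 display of Lemma 2 (quoting [11] before publication) shows a single
bilinear form with the factor `2^{η^{-7}}`, no condition (2), no restriction `z ≤ √(MN)`, and
`E ≪ η s² e^K + η⁻⁸ e^{K−s} (log MN)^{−1/3}`; we vendor the published theorem, which is weaker in
form (a sum of `< exp(8ε⁻³)` bilinear forms) and is what the proof of Proposition 2 uses (summing
the Corollary of Proposition 1 over `l`).  We also assume `ω ≥ 0` (true in every application),
which only weakens the statement. [cite: IwaniecInventiones1978, Lemma 2] -/
def lemma2_bilinearSieve : Prop :=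
  ∃ c₀ : ℝ, 0 < c₀ ∧
    ∀ (F f : ℝ → ℝ), IsLinearSieveFunctions F f →
    ∀ (ε M N : ℝ), 0 < ε → ε < 1 / 3 → 1 < M → 1 < N →
      ∃ (L : ℕ) (au bu al bl : ℕ → ℕ → ℝ),
        (L : ℝ) ≤ Real.exp (8 * ε⁻¹ ^ 3) ∧
        (∀ l m, |au l m| ≤ 1) ∧ (∀ l n, |bu l n| ≤ 1) ∧ (∀ l m, |al l m| ≤ 1) ∧
        (∀ l n, |bl l n| ≤ 1) ∧
        ∀ (B : Multiset ℤ) (X : ℝ) (ω : ArithmeticFunction ℝ) (K Lc : ℝ),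
          0 < X → ω.IsMultiplicative → (∀ n, 0 ≤ ω n) → (∀ p : ℕ, p.Prime → ω p < p) →
          1 ≤ K → 1 ≤ Lc →
          (∀ w z : ℝ, 2 ≤ w → w < z →
            ∏ p ∈ (Nat.primesBelow ⌈z⌉₊).filter (fun p : ℕ => w ≤ (p : ℝ)), (1 - ω p / p)⁻¹ ≤
              Real.log z / Real.log w * (1 + K / Real.log w)) →
          (∀ w z : ℝ, 2 ≤ w → w < z → ∀ A : ℕ,
            ∑ p ∈ (Nat.primesBelow ⌈z⌉₊).filter (fun p : ℕ => w ≤ (p : ℝ)),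
                ∑ a ∈ Finset.Icc 2 A, ω (p ^ a) / (p : ℝ) ^ a ≤ Lc / Real.log (3 * w)) →
          ∀ z : ℝ, 2 ≤ z → z ≤ (M * N) ^ (1 / 2 : ℝ) →
            let s : ℝ := Real.log (M * N) / Real.log z
            let E : ℝ := c₀ * (ε + ε⁻¹ ^ 8 * Real.exp (K + Lc) * Real.log (M * N) ^ (-(1 / 3 : ℝ)))
            let V : ℝ := ∏ p ∈ Nat.primesBelow ⌈z⌉₊, (1 - ω p / p)
            let r : ℕ → ℝ := fun d => (mcount B d : ℝ) - ω d / d * X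
            let R : (ℕ → ℕ → ℝ) → (ℕ → ℕ → ℝ) → ℝ := fun a b =>
              ∑ l ∈ Finset.range L, ∑ m ∈ Finset.Ico 1 ⌈M⌉₊, ∑ n ∈ Finset.Ico 1 ⌈N⌉₊,
                if m * n ∣ primesProdBelow z then a l m * b l n * r (m * n) else 0
            (msifted B z : ℝ) ≤ V * X * (F s + E) + R au bu ∧
              V * X * (f s - E) - R al bl ≤ (msifted B z : ℝ)

/-! ### §4. Proposition 1, its Corollary and Lemma 6 — named facts (Lemma 4: see the note) -/

/-- `B(x; m, N) = ∑_{n < N, (n, m) = 1} b_n r(𝒜; mn)` (p. 175, bottom) for a coefficient sequence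
`b`. [cite: IwaniecInventiones1978, §4 p. 175] -/
def bilinearB (x : ℝ) (b : ℕ → ℝ) (m : ℕ) (N : ℝ) : ℝ :=
  ∑ n ∈ (Finset.Ico 1 ⌈N⌉₊).filter (fun n : ℕ => n.Coprime m), b n * rem x (m * n)

/-- **Iwaniec 1978, Proposition 1 (p. 176).**  For real `b_n` with `|b_n| ≤ 1` and `b_n = 0`
unless `n` is squarefree (p. 175), `M < x` and `ε > 0`:
`∑_{M < m < 2M} B(x; m, N)² ≪_ε (1 + N^{7/2} M^{−5/4} x) x^{1+ε}`, the implied constant depending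
on `ε` alone (dispersion method + Lemma 4).  Rendered for `1 ≤ M < x`, `N ≥ 1`.
[cite: IwaniecInventiones1978, Proposition 1] -/
def proposition1 : Prop :=
  ∀ ε : ℝ, 0 < ε → ∃ C : ℝ, ∀ (x M N : ℝ) (b : ℕ → ℝ), 1 ≤ M → M < x → 1 ≤ N →
    (∀ n, |b n| ≤ 1) → (∀ n, ¬ Squarefree n → b n = 0) →
      ∑ m ∈ (Finset.Icc 1 ⌈2 * M⌉₊).filter (fun m : ℕ => M < m ∧ (m : ℝ) < 2 * M),
          bilinearB x b m N ^ 2 ≤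
        C * (1 + N ^ (7 / 2 : ℝ) * M ^ (-(5 / 4 : ℝ)) * x) * x ^ (1 + ε)

/-- **Iwaniec 1978, Corollary of Proposition 1 (p. 176): level of distribution `x^{16/15}` for
`n² + 1` in bilinear form.**  For every `ε > 0`, uniformly in real `b_n` with `|b_n| ≤ 1`
supported on squarefree `n`:
`∑_{m < x^{1−4ε}} |∑_{n < x^{1/15−ε}, (n,m)=1} b_n r(𝒜; mn)| ≪_ε x^{1−ε}`.
(p. 185: under Hooley's Hypothesis R on incomplete Kloosterman sums `1/15` may be replaced by
`1/9`.)
[cite: IwaniecInventiones1978, Corollary p. 176] -/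
def proposition1_corollary : Prop :=
  ∀ ε : ℝ, 0 < ε → ∃ C : ℝ, ∀ (x : ℝ) (b : ℕ → ℝ), 2 ≤ x →
    (∀ n, |b n| ≤ 1) → (∀ n, ¬ Squarefree n → b n = 0) →
      ∑ m ∈ Finset.Ico 1 ⌈x ^ (1 - 4 * ε)⌉₊, |bilinearB x b m (x ^ (1 / 15 - ε))| ≤
        C * x ^ (1 - ε)

/-! #### Lemma 4 (p. 177) is NOT vendored: the printed main term is wrong

Review of this file (p8496) found that Lemma 4 as printed — `P(M₁, M; q, d, μ, ω, α, β)
= (π/4)(β − α)(M₁ − M) ρ(q/d) A(q)/φ(d) + O((qM)^{3/4+ε})`, `A(q) = (φ(q)/q)²/(2, q)` — is false: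
for `q = d = 1`, `α = 0`, `β = 1/2` the count is `½ ∑_{M<m<M₁} ρ(m) ∼ (3/(4π))(M₁ − M)`
(`∑ ρ(m) m^{-s} = ζ(s) L(s, χ₄)/ζ(2s)`), not `(π/8)(M₁ − M)`; the printed main term is too large
by the factor `ζ(2) = π²/6` (the proof on p. 179 uses `ρ(m) = ∑_{a ∣ m} χ₄(a)`, which fails for
non-squarefree `m`; exact counts `M = 1000, 4000, 16000` give `239, 953, 3817` against the printed
`392, 1570, 6283`).  The slip is harmless for Proposition 1, where the three main terms produced by
Lemma 4 cancel identically in the dispersion `W − 2xV + x²U` (p. 177, (8)–(20)) whatever the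
constant, which is why the Theorem stands; the exposition arXiv:1910.02885 (Prop. 6) carries the
factor `6/π²`.  A corrected Lemma 4 (with its source) is left to the session that attacks
Proposition 1; only Lemma 6, its genuinely external input, is vendored here. -/

/-- **Iwaniec 1978, Lemma 6 (p. 178) = Hooley, Acta Math. 117 (1967), Lemma 3 (a consequence of
Weil's estimate for Kloosterman sums).**  If `h` and `s ≥ 1` are integers and `0 < r₂ − r₁ < 2s`,
then for all integers `λ` and moduli `Λ ≥ 1`,
`∑_{r₁ < r < r₂, (r,s)=1, r ≡ λ (mod Λ)} e(h r̄ / s) ≪_ε s^{1/2+ε} (h, s)^{1/2}`, where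
`r r̄ ≡ 1 (mod s)` and `e(t) = exp(2πit)`. [cite: IwaniecInventiones1978, Lemma 6] -/
def lemma6_hooley : Prop :=
  ∀ ε : ℝ, 0 < ε → ∃ C : ℝ, ∀ (s Λ : ℕ) (h r₁ r₂ lam : ℤ), 1 ≤ s → 1 ≤ Λ → r₁ < r₂ →
    r₂ - r₁ < 2 * s →
      ‖∑ r ∈ (Finset.Ioo r₁ r₂).filter (fun r : ℤ => Int.gcd r s = 1 ∧ r ≡ lam [ZMOD Λ]),
          Complex.exp (2 * Real.pi * Complex.I *
            ((h : ℂ) * ((((r : ZMod s)⁻¹).val : ℕ) : ℂ) / (s : ℂ)))‖ ≤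
        C * (s : ℝ) ^ (1 / 2 + ε) * Real.sqrt (Int.gcd h s)

/-! ### §5. Proposition 2 — named facts -/

/-- **Iwaniec 1978, Proposition 2 (p. 185), upper bound.**  Let `y = x^{16/15}`, `0 < γ < 1/2`,
`z = x^γ`, `z ≤ z_q < x^{1/2}` and `0 ≤ c_q ≤ 1`.  Then for any `ε > 0` and `x > x₀(ε, γ)`
(uniformly in the families `c_q`, `z_q`),
`∑_{q < x^{1−ε}, (q, P(z_q)) = 1} c_q S(𝒜_q; z_q)
   < V(z) x {∑_{q < x^{1−ε}, (q, P(z_q)) = 1} c_q (ρ(q)/q) F(log(y/q)/log z_q) (log z/log z_q)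
             + O_γ(ε)}`
(consequence of Lemma 2 and the Corollary of Proposition 1).  `O_γ(ε)` is rendered as `C_γ ε` with
`C_γ` depending on `γ` (and on nothing else); `F` is any upper linear-sieve function in the sense of
`IsLinearSieveFunctions`. [cite: IwaniecInventiones1978, Proposition 2] -/
def proposition2_upper : Prop :=
  ∀ (F f : ℝ → ℝ), IsLinearSieveFunctions F f →
    ∀ γ : ℝ, 0 < γ → γ < 1 / 2 → ∃ Cγ : ℝ, ∀ ε : ℝ, 0 < ε → ∃ x₀ : ℝ, ∀ x : ℝ, x₀ ≤ x →
      ∀ (zq : ℕ → ℝ) (c : ℕ → ℝ), (∀ q, x ^ γ ≤ zq q ∧ zq q < x ^ (1 / 2 : ℝ)) →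
        (∀ q, 0 ≤ c q ∧ c q ≤ 1) →
        let Q := (Finset.Ico 1 ⌈x ^ (1 - ε)⌉₊).filter fun q : ℕ =>
          q.Coprime (primesProdBelow (zq q))
        ∑ q ∈ Q, c q * (siftedCount x q (zq q) : ℝ) ≤
          densityProd (x ^ γ) * x *
            (∑ q ∈ Q, c q * (rho q : ℝ) / q *
                F (Real.log (x ^ (16 / 15 : ℝ) / q) / Real.log (zq q)) *
                  (Real.log (x ^ γ) / Real.log (zq q)) + Cγ * ε)

/-- **Iwaniec 1978, Proposition 2 (p. 185), lower bound** ("A similar result holds for lower bound,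
the function `F(s)` being replaced by `f(s)`"): with the same data,
`∑ c_q S(𝒜_q; z_q) > V(z) x {∑ c_q (ρ(q)/q) f(log(y/q)/log z_q)(log z/log z_q) − O_γ(ε)}`.
[cite: IwaniecInventiones1978, Proposition 2] -/
def proposition2_lower : Prop :=
  ∀ (F f : ℝ → ℝ), IsLinearSieveFunctions F f →
    ∀ γ : ℝ, 0 < γ → γ < 1 / 2 → ∃ Cγ : ℝ, ∀ ε : ℝ, 0 < ε → ∃ x₀ : ℝ, ∀ x : ℝ, x₀ ≤ x →
      ∀ (zq : ℕ → ℝ) (c : ℕ → ℝ), (∀ q, x ^ γ ≤ zq q ∧ zq q < x ^ (1 / 2 : ℝ)) →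
        (∀ q, 0 ≤ c q ∧ c q ≤ 1) →
        let Q := (Finset.Ico 1 ⌈x ^ (1 - ε)⌉₊).filter fun q : ℕ =>
          q.Coprime (primesProdBelow (zq q))
        densityProd (x ^ γ) * x *
            (∑ q ∈ Q, c q * (rho q : ℝ) / q *
                f (Real.log (x ^ (16 / 15 : ℝ) / q) / Real.log (zq q)) *
                  (Real.log (x ^ γ) / Real.log (zq q)) - Cγ * ε) ≤
          ∑ q ∈ Q, c q * (siftedCount x q (zq q) : ℝ)

end Literature.NumberTheory.Sieve.Iwaniec1978

end
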